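import Literature.Computability.AlgebraicComplexity.DDS21PiSigmaClosedProofs
import Literature.RingTheory.MvPolynomial.DegreeOfTruncation
import HarnessLib

/-!
# DDS 2021, Def. 2.5: a closure toolkit for ABPs with univariate edge labels (proved)

Typed literature (cell `val-lit`, cross-ladder typing row X2-DDS21 brick B1 "ABP toolkit"; desk
lead-np). Source: P. Dutta, P. Dwivedi, N. Saxena, *Demystifying the border of depth-3 algebraic
circuits*, FOCS 2021 / full version [DuttaDwivediSaxena2022] (held text
`paper:galaxy-pdf-7641649743695546420`, chunk `p0018`, printed lines L468–478).

The tree's `DDS2021.UABPComputes S f` (`DDS21BorderDepthThree.lean`, DDS Def. 2.5) says that some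
layered ABP on `≤ S` vertices with univariate edge labels of degree `≤ S` computes `f` as the
`(s,t)` entry of the `(layer t − layer s)`-th power of its label matrix. The de-bordering
inductions of DDS §3 (Thm. 3.2) and §5 use, at every step, the remark printed right after Def. 2.5
(p0018 L477–478): "We remark that ABP is closed under both addition and multiplication, which is
straightforward from the definition." This file PROVES that remark for the tree's predicate, with
explicit (linear) size bookkeeping, in the LENGTH-AWARE refinement `UABPComputesLen S L f` (the
same witness, plus the length `L = layer t − layer s` of the program as an index; parallel
composition needs programs of equal length, series composition adds lengths):

* conversions `UABPComputesLen.uabpComputes`, `UABPComputes.exists_len`; transport from any finite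
  vertex type `UABPComputesLen.of_fintype`; `mono`;
* atoms: `zero`, `of_label` (one edge carrying a univariate label), `of_C`, `of_X`;
* `pad` (lengthen by a chain of unit edges: `S + d`, `L + d`);
* series composition `mul` (`S₁ + S₂`, `L₁ + L₂ + 1`), `smul_C`;
* parallel composition `sum` over a `Fintype` (`card ι * S + 2`, `L + 2`), `add` (common length),
  `add'` (any lengths, via `pad`);
* `prod` over a `Finset` (`2 + card * S`, `1 + card * (L + 1)`);
* over a commutative ring of coefficients: `neg`, `sub`;
* (Layer 2) `pow`, `sum_le` (unequal lengths), `sum_smul_C` (linear combinations), `geom_sum`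
  (truncated geometric series), `bind₁_affine` / `eval_var` (affine univariate substitutions,
  partial evaluation — the ABP side of the interpolation in Lemma 2.6);
* (Layer 3) `homogeneousComponent`, `truncate` (degree truncation "mod `⟨x⟩^{D+1}`" by the
  degree-graded copy, Lemma 2.6 / Strassen);
* (Layer 4) `of_affine`, `of_isSPS` / `uabpComputes_of_mem_spsClass` (`Σ^{[k]}Π^{[d]}Σ` circuits
  have small ABPs), `of_mem_swsClass` / `uabpComputes_of_mem_swsClass` (`Σ∧Σ ⊆ ABP` directly) and `uabpComputes_of_mem_border_spsClass_one` = the `k = 1` case of Thm. 3.2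
  PROVED with exponent `5` (via the tree's `DDS2021_lemma_2_21_piSigma_holds`);
* (Layer 5) `UABPComputesLen.length_lt` (`f ≠ 0 ⇒ L < S`) and the restatements on the tree's
  predicate: `UABPComputes.mul / add / sum / smul_C / bind₁_affine / homogeneousComponent`;
* (Layer 6, the ABP-side calculus of the DiDIL induction of §3, in the frame of Claim 3.7 /
  p0036 L959–961: `z` is a VARIABLE of the programs, `ε` never enters them) `bind₁_affine'`
  (affine substitutions into another variable set), `rename`, `map` (same `S, L`);
  `derivation` / `pderiv` ("Derive": the two-copy construction, `2 S`, same `L`);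
  `weightedHomogeneousComponent` / `truncateWeighted` (graded copy for any weight; with
  `coeff_truncateDegreeOf` / `truncateDegreeOf_eq_self` this is reduction "mod `z^{D+1}`");
  `aeval_phi` (the map `Φ : x_i ↦ z x_i + α_i`, p0028 L751) and `of_aeval_phi` ("apply `Φ^{-1}`",
  p0036 L961; same `S, L`);
* (Layer 7) `bind₁_univariate` (univariate substitutions of degree `≤ e`: budget `S · e`, same
  `L`) and **DDS Lemma 2.6 = Strassen's division elimination, polynomial case, PROVED**:
  `truncate_mul_geom_sum_eq_of_mul_eq` (the algebra of the truncated inverse identity),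
  `UABPComputesLen.divElim` (explicit budget), `UABPComputes.divElim` (`100 · s^5`),
  `UABPComputes.divElim_of_infinite`;
* (Layer 8) the link with the tree's generic "mod `x_i^D`" operator
  (`Literature/RingTheory/MvPolynomial/DegreeOfTruncation.lean`): `UABPComputesLen.truncDegreeOf`
  (`D · S · D + 2`, `L + 2`), `UABPComputesLen.integrateDegreeOf` (termwise integration in `x_i`,
  `D · (2 + S · D) + 2`, `L + 4`), and the length-free restatements `UABPComputes.rename / map /
  pderiv / weightedHomogeneousComponent / truncDegreeOf / integrateDegreeOf / aeval_phi /
  of_aeval_phi`.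

All other statements are over a commutative semiring of coefficients (as `UABPComputes`). Budgets
are stated as explicit linear expressions (no asymptotic constants), so that the size bookkeeping
of DDS §3/§5 ("size blowup", p0036 L952–964) can be carried out by `omega`/`ring`. 0 named facts;
every declaration is proved (the matrix bookkeeping: powers of block-upper-triangular matrices,
`fromBlocks_zero₂₁_pow_eq`, and of "bordered" matrices, `srcSnk_pow_src_snk`).
-/

namespace Literature.Computability.AlgebraicComplexity

namespace DDS2021

open MvPolynomial

/-! ## Matrix bookkeeping (generic semiring entries) -/

section MatrixLemmas

variable {R : Type*} [Semiring R]

/-- In a layered label matrix (every nonzero entry `N u v` goes up exactly one layer) the `k`-th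
power only connects vertices exactly `k` layers apart. [cite: DuttaDwivediSaxena2022, Def. 2.5 (full version p0017 L468 – p0018 L472: "All edges connect vertices from layer i to i+1")] -/
theorem pow_apply_eq_zero_of_layer {ι : Type*} [Fintype ι] [DecidableEq ι]
    {N : Matrix ι ι R} {layer : ι → ℕ} (hN : ∀ u v, N u v ≠ 0 → layer v = layer u + 1) :
    ∀ (k : ℕ) (u v : ι), layer v ≠ layer u + k → (N ^ k) u v = 0 := by
  intro k
  induction k with
  | zero =>
    intro u v h
    rw [pow_zero, Matrix.one_apply]
    split_ifs with huv
    · exact absurd (by rw [huv, Nat.add_zero]) h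
    · rfl
  | succ k ih =>
    intro u v h
    rw [pow_succ, Matrix.mul_apply]
    refine Finset.sum_eq_zero fun w _ => ?_
    by_cases hw : (N ^ k) u w = 0
    · rw [hw, zero_mul]
    · by_cases hwv : N w v = 0
      · rw [hwv, mul_zero]
      · exfalso
        apply h
        have h1 : layer w = layer u + k := by
          by_contra hc
          exact hw (ih u w hc)
        rw [hN w v hwv, h1, Nat.add_assoc]

/-- Powers of a block-upper-triangular matrix, with the off-diagonal block made explicit:
`[[A, B], [0, D]] ^ k = [[A ^ k, ∑_{i<k} A ^ i B D ^ (k-1-i)], [0, D ^ k]]`. [folklore] -/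
private theorem fromBlocks_zero₂₁_pow_eq {l m : Type*} [Fintype l] [Fintype m] [DecidableEq l]
    [DecidableEq m] (A : Matrix l l R) (B : Matrix l m R) (D : Matrix m m R) (k : ℕ) :
    (Matrix.fromBlocks A B 0 D) ^ k =
      Matrix.fromBlocks (A ^ k) (∑ i ∈ Finset.range k, A ^ i * B * D ^ (k - 1 - i)) 0 (D ^ k) := by
  induction k with
  | zero => simp [Matrix.fromBlocks_one]
  | succ k ih =>
    rw [pow_succ, ih, Matrix.fromBlocks_multiply]
    simp only [Matrix.mul_zero, add_zero, Matrix.zero_mul, zero_add, ← pow_succ]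
    congr 1
    rw [Finset.sum_range_succ, Matrix.sum_mul, show k + 1 - 1 - k = 0 from by omega, pow_zero,
      Matrix.mul_one, add_comm]
    congr 1
    refine Finset.sum_congr rfl fun i hi => ?_
    rw [Finset.mem_range] at hi
    rw [show k + 1 - 1 - i = k - 1 - i + 1 from by omega, pow_succ, Matrix.mul_assoc]

/-- The "bordered" label matrix on `Fin 2 ⊕ β`: a source `inl 0` with out-labels `a`, a sink
`inl 1` with in-labels `b`, and the body `β` with label matrix `B` (plumbing for `sum`). [folklore] -/
private def srcSnk {β : Type*} (a b : β → R) (B : Matrix β β R) :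
    Matrix (Fin 2 ⊕ β) (Fin 2 ⊕ β) R :=
  Matrix.of fun p q =>
    match p, q with
    | Sum.inl i, Sum.inr y => if i = 0 then a y else 0
    | Sum.inr x, Sum.inl j => if j = 1 then b x else 0
    | Sum.inr x, Sum.inr y => B x y
    | Sum.inl _, Sum.inl _ => 0

variable {β : Type*} (a b : β → R) (B : Matrix β β R)

/-- Entries of `srcSnk`: source row. [folklore] -/
@[simp] private theorem srcSnk_inl_inr (i : Fin 2) (y : β) :
    srcSnk a b B (Sum.inl i) (Sum.inr y) = if i = 0 then a y else 0 := rfl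
/-- Entries of `srcSnk`: sink column. [folklore] -/
@[simp] private theorem srcSnk_inr_inl (x : β) (j : Fin 2) :
    srcSnk a b B (Sum.inr x) (Sum.inl j) = if j = 1 then b x else 0 := rfl
/-- Entries of `srcSnk`: body block. [folklore] -/
@[simp] private theorem srcSnk_inr_inr (x y : β) :
    srcSnk a b B (Sum.inr x) (Sum.inr y) = B x y := rfl
/-- Entries of `srcSnk`: no source/sink loops or shortcut. [folklore] -/
@[simp] private theorem srcSnk_inl_inl (i j : Fin 2) :
    srcSnk a b B (Sum.inl i) (Sum.inl j) = 0 := rfl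

variable [Fintype β] [DecidableEq β]

/-- Nothing enters the source. [folklore] -/
private theorem srcSnk_pow_inl_zero (k : ℕ) (x : β) :
    (srcSnk a b B ^ k) (Sum.inr x) (Sum.inl 0) = 0 := by
  induction k with
  | zero => rw [pow_zero, Matrix.one_apply_ne (by simp)]
  | succ k ih =>
    rw [pow_succ, Matrix.mul_apply]
    refine Finset.sum_eq_zero fun z _ => ?_
    rcases z with i | w
    · simp
    · simp

/-- Inside the body, powers of the bordered matrix are powers of the body matrix. [folklore] -/
private theorem srcSnk_pow_inr_inr (k : ℕ) (x y : β) :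
    (srcSnk a b B ^ k) (Sum.inr x) (Sum.inr y) = (B ^ k) x y := by
  induction k generalizing y with
  | zero => simp [Matrix.one_apply]
  | succ k ih =>
    rw [pow_succ, pow_succ, Matrix.mul_apply, Matrix.mul_apply, Fintype.sum_sum_type]
    simp only [srcSnk_inr_inr, ih, Fin.sum_univ_two, srcSnk_inl_inr, Fin.isValue, if_true,
      one_ne_zero, if_false, mul_zero, add_zero, srcSnk_pow_inl_zero, zero_mul, zero_add]

/-- The `(source, sink)` entry of the `(k+2)`-th power of the bordered matrix:
`∑_{x y} a x · (B ^ k) x y · b y`. [folklore] -/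
private theorem srcSnk_pow_src_snk (k : ℕ) :
    (srcSnk a b B ^ (k + 2)) (Sum.inl 0) (Sum.inl 1) = ∑ x, ∑ y, a x * ((B ^ k) x y * b y) := by
  rw [pow_succ, pow_succ', Matrix.mul_apply]
  simp [Fintype.sum_sum_type, Matrix.mul_apply, srcSnk_pow_inr_inr, Finset.sum_mul,
    mul_assoc]
  exact Finset.sum_comm

/-- `A · Q · D` with `Q` the single unit entry at `(t₁, s₂)`: entry `(u,v)` is `A u t₁ · D s₂ v`.
[folklore] -/
private theorem mul_bridge_mul_apply {m₁ m₂ : Type*} [Fintype m₁] [Fintype m₂] [DecidableEq m₁]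
    [DecidableEq m₂] (A : Matrix m₁ m₁ R) (D : Matrix m₂ m₂ R) (t₁ u : m₁) (s₂ v : m₂) :
    (A * (Matrix.of fun x y => if x = t₁ then (if y = s₂ then (1 : R) else 0) else 0) * D) u v =
      A u t₁ * D s₂ v := by
  simp [Matrix.mul_apply, Matrix.of_apply, mul_ite, ite_mul, Finset.sum_ite_eq']

/-- The value of the parallel composition: with unit labels from the source to every `s i` and
from every `t i` to the sink over a block-diagonal body, `∑_{x y} a x (blockDiagonal' M) x y b y
= ∑ i, M i (s i) (t i)`. [folklore] -/
private theorem sum_bridge_blockDiagonal' {ι : Type*} [Fintype ι] [DecidableEq ι] {V : ι → ℕ}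
    (M : ∀ i, Matrix (Fin (V i)) (Fin (V i)) R) (s t : ∀ i, Fin (V i)) :
    ∑ x : (Σ i, Fin (V i)), ∑ y : (Σ i, Fin (V i)),
      (if x.2 = s x.1 then (1 : R) else 0) *
        (Matrix.blockDiagonal' M x y * (if y.2 = t y.1 then (1 : R) else 0)) =
      ∑ i, M i (s i) (t i) := by
  rw [Fintype.sum_sigma]
  refine Finset.sum_congr rfl fun i _ => ?_
  rw [Finset.sum_eq_single (s i) (fun u _ hu => by simp [hu]) (by simp)]
  simp only [if_true, one_mul]
  rw [Fintype.sum_sigma, Finset.sum_eq_single i (fun i' _ hi' => ?_) (by simp)]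
  · rw [Finset.sum_eq_single (t i) (fun v _ hv => by simp [hv]) (by simp)]
    simp [Matrix.blockDiagonal'_apply_eq]
  · refine Finset.sum_eq_zero fun v _ => ?_
    rw [Matrix.blockDiagonal'_apply_ne M (s i) v (Ne.symm hi'), zero_mul]

end MatrixLemmas

/-! ## The length-aware predicate and its basic API -/

section Toolkit

variable {F : Type*} [CommSemiring F] {n : ℕ}

/-- **Length-aware form of DDS Def. 2.5** (p0017 L468 – p0018 L476): `UABPComputesLen S L f` —
there is a layered ABP with univariate edge labels, at most `S` vertices, all label degrees `≤ S`,
whose sink lies exactly `L` layers above its source ("All edges connect vertices from layer `i` to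
`i+1`", so every source–sink path has exactly `L` edges), computing `f` as the `(s,t)` entry of the
`L`-th power of the label matrix (= `∑_{path γ : s ⇝ t} wt(γ)`). It refines the tree's
`UABPComputes S f` (= `∃ L, UABPComputesLen S L f`, see `UABPComputes.exists_len` and
`UABPComputesLen.uabpComputes`); the length index is what makes parallel composition typecheck.
[cite: DuttaDwivediSaxena2022, Def. 2.5 (full version p0017 L468 – p0018 L476)] -/
def UABPComputesLen (S L : ℕ) (f : MvPolynomial (Fin n) F) : Prop :=
  ∃ (V : ℕ) (_ : V ≤ S) (layer : Fin V → ℕ) (s t : Fin V)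
    (N : Matrix (Fin V) (Fin V) (MvPolynomial (Fin n) F)),
    (∀ u v, N u v ≠ 0 → layer v = layer u + 1) ∧
      (∀ u v, (N u v).vars.card ≤ 1 ∧ (N u v).totalDegree ≤ S) ∧
        layer t = layer s + L ∧ (N ^ L) s t = f

/-- Forgetting the length: a length-`L` witness is a DDS Def. 2.5 witness.
[cite: DuttaDwivediSaxena2022, Def. 2.5 (full version p0018 L474–476)] -/
theorem UABPComputesLen.uabpComputes {S L : ℕ} {f : MvPolynomial (Fin n) F}
    (h : UABPComputesLen S L f) : UABPComputes S f := by
  obtain ⟨V, hV, layer, s, t, N, hlay, hlab, hst, hf⟩ := h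
  refine ⟨V, hV, layer, s, t, N, hlay, hlab, ?_⟩
  rw [hst, Nat.add_sub_cancel_left]
  exact hf

/-- Every DDS Def. 2.5 witness has a length (if the sink lies below the source the computed
polynomial is `0`, which has witnesses of every length on the same vertex set).
[cite: DuttaDwivediSaxena2022, Def. 2.5 (full version p0018 L474–476)] -/
theorem UABPComputes.exists_len {S : ℕ} {f : MvPolynomial (Fin n) F} (h : UABPComputes S f) :
    ∃ L, UABPComputesLen S L f := by
  obtain ⟨V, hV, layer, s, t, N, hlay, hlab, hf⟩ := h
  by_cases hle : layer s ≤ layer t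
  · exact ⟨layer t - layer s, V, hV, layer, s, t, N, hlay, hlab, by omega, hf⟩
  · have hst : s ≠ t := by
      rintro rfl
      exact hle le_rfl
    have hf0 : f = 0 := by
      rw [← hf, show layer t - layer s = 0 from by omega, pow_zero, Matrix.one_apply_ne hst]
    refine ⟨0, V, hV, fun _ => 0, s, t, 0, fun u v h => absurd rfl h, fun u v => ?_, rfl, ?_⟩
    · simp
    · rw [pow_zero, Matrix.one_apply_ne hst, hf0]

/-- Monotonicity of the budget. [cite: DuttaDwivediSaxena2022, Def. 2.5 (full version p0018 L474–476)] -/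
theorem UABPComputesLen.mono {S S' L : ℕ} (h : S ≤ S') {f : MvPolynomial (Fin n) F}
    (hf : UABPComputesLen S L f) : UABPComputesLen S' L f := by
  obtain ⟨V, hV, layer, s, t, N, h1, h2, h3, h4⟩ := hf
  exact ⟨V, hV.trans h, layer, s, t, N, h1, fun u v => ⟨(h2 u v).1, (h2 u v).2.trans h⟩, h3, h4⟩

/-- Transport: a witness on ANY finite vertex type `ι` (with `card ι ≤ S`) gives
`UABPComputesLen S L f` (re-index along `Fintype.equivFin`). This is how all constructions below
are assembled (on sum / sigma types) before being stated on `Fin V`.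
[cite: DuttaDwivediSaxena2022, Def. 2.5 (full version p0017 L468 – p0018 L476)] -/
theorem UABPComputesLen.of_fintype {ι : Type*} [Fintype ι] [DecidableEq ι] {S L : ℕ}
    {f : MvPolynomial (Fin n) F} (hV : Fintype.card ι ≤ S) (layer : ι → ℕ) (s t : ι)
    (N : Matrix ι ι (MvPolynomial (Fin n) F)) (hlay : ∀ u v, N u v ≠ 0 → layer v = layer u + 1)
    (hlab : ∀ u v, (N u v).vars.card ≤ 1 ∧ (N u v).totalDegree ≤ S)
    (hst : layer t = layer s + L) (hf : (N ^ L) s t = f) : UABPComputesLen S L f := by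
  classical
  set e := Fintype.equivFin ι with he
  refine ⟨Fintype.card ι, hV, layer ∘ e.symm, e s, e t, Matrix.reindex e e N, ?_, ?_, ?_, ?_⟩
  · intro u v h
    simp only [Matrix.reindex_apply, Matrix.submatrix_apply] at h
    simpa using hlay _ _ h
  · intro u v
    exact hlab _ _
  · simp [hst]
  · have hpow : (Matrix.reindex e e N) ^ L = Matrix.reindex e e (N ^ L) := by
      have := (Matrix.reindexAlgEquiv F (MvPolynomial (Fin n) F) e).map_pow N L
      simpa [Matrix.coe_reindexAlgEquiv] using this.symm
    rw [hpow]
    simp [hf]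

/-- A label that is `1` or `0` is univariate of degree `0`. [folklore] -/
private theorem label_ite_one (c : Prop) [Decidable c] (S : ℕ) :
    ((if c then (1 : MvPolynomial (Fin n) F) else 0).vars.card ≤ 1) ∧
      (if c then (1 : MvPolynomial (Fin n) F) else 0).totalDegree ≤ S := by
  by_cases h : c <;> simp [h]

/-! ## Atoms -/

/-- The zero polynomial has witnesses of every length (two isolated vertices).
[cite: DuttaDwivediSaxena2022, Def. 2.5 (full version p0017 L468 – p0018 L476)] -/
theorem UABPComputesLen.zero {S : ℕ} (hS : 2 ≤ S) (L : ℕ) :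
    UABPComputesLen S L (0 : MvPolynomial (Fin n) F) := by
  refine ⟨2, hS, fun v => if v = 0 then 0 else L, 0, 1, 0, fun u v h => absurd rfl h,
    fun u v => by simp, by simp, ?_⟩
  rcases Nat.eq_zero_or_pos L with rfl | hL
  · rw [pow_zero, Matrix.one_apply_ne (by decide)]
  · rw [zero_pow hL.ne', Matrix.zero_apply]

/-- One edge `s → t` carrying a univariate label `p` of degree `≤ S` (and `2 ≤ S` for the two
vertices): `p` has a witness of length `1`. [cite: DuttaDwivediSaxena2022, Def. 2.5 (full version p0017 L468 – p0018 L476)] -/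
theorem UABPComputesLen.of_label {S : ℕ} (hS : 2 ≤ S) (p : MvPolynomial (Fin n) F)
    (hvars : p.vars.card ≤ 1) (hdeg : p.totalDegree ≤ S) : UABPComputesLen S 1 p := by
  refine ⟨2, hS, fun v => if v = 0 then 0 else 1, 0, 1,
    Matrix.of fun u v => if u = 0 ∧ v = 1 then p else 0, ?_, ?_, by simp, ?_⟩
  · intro u v h
    simp only [Matrix.of_apply, ne_eq, ite_eq_right_iff, Classical.not_imp] at h
    obtain ⟨⟨rfl, rfl⟩, -⟩ := h
    simp
  · intro u v
    simp only [Matrix.of_apply]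
    split_ifs
    · exact ⟨hvars, hdeg⟩
    · simp
  · simp

/-- Constants: `C c` has a witness of length `1` within any budget `S ≥ 2`.
[cite: DuttaDwivediSaxena2022, Def. 2.5 (full version p0017 L468 – p0018 L476)] -/
theorem UABPComputesLen.of_C {S : ℕ} (hS : 2 ≤ S) (c : F) :
    UABPComputesLen S 1 (C c : MvPolynomial (Fin n) F) :=
  UABPComputesLen.of_label hS _ (by simp [vars_C]) (by simp)

/-- Variables: `X i` has a witness of length `1` within any budget `S ≥ 2`.
[cite: DuttaDwivediSaxena2022, Def. 2.5 (full version p0017 L468 – p0018 L476)] -/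
theorem UABPComputesLen.of_X {S : ℕ} (hS : 2 ≤ S) (i : Fin n) :
    UABPComputesLen S 1 (X i : MvPolynomial (Fin n) F) := by
  rcases subsingleton_or_nontrivial F with hF | hF
  · have h0 : (X i : MvPolynomial (Fin n) F) = 0 := by
      rw [← one_mul (X i), ← C_1, Subsingleton.elim (1 : F) 0, C_0, zero_mul]
    rw [h0]
    exact UABPComputesLen.zero hS 1
  · exact UABPComputesLen.of_label hS _ (by simp [vars_X]) (by rw [totalDegree_X]; omega)

/-! ## Padding and series composition (multiplication) -/

/-- One more unit edge in front of the source (`S + 1` vertices, length `L + 1`). [folklore] -/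
private theorem UABPComputesLen.pad_one {S L : ℕ} {f : MvPolynomial (Fin n) F}
    (hf : UABPComputesLen S L f) : UABPComputesLen (S + 1) (L + 1) f := by
  obtain ⟨V, hV, layer, s, t, N, hlay, hlab, hst, hf⟩ := hf
  let E : Matrix (Fin 1) (Fin V) (MvPolynomial (Fin n) F) :=
    Matrix.of fun _ v => if v = s then 1 else 0
  refine UABPComputesLen.of_fintype (ι := Fin 1 ⊕ Fin V) (by simp; omega)
    (Sum.elim (fun _ => layer s) (fun v => layer v + 1)) (Sum.inl 0) (Sum.inr t)
    (Matrix.fromBlocks 0 E 0 N) ?_ ?_ ?_ ?_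
  · rintro (u | u) (v | v) h
    · simp at h
    · have hv : v = s := by
        by_contra hvs
        exact h (by simp [E, hvs])
      subst hv
      simp
    · simp at h
    · simp only [Matrix.fromBlocks_apply₂₂] at h
      simp [hlay u v h]
  · rintro (u | u) (v | v)
    · simp
    · simp only [Matrix.fromBlocks_apply₁₂, E, Matrix.of_apply]
      exact label_ite_one _ _
    · simp
    · exact ⟨(hlab u v).1, (hlab u v).2.trans (Nat.le_succ S)⟩
  · simp only [Sum.elim_inl, Sum.elim_inr, hst, Nat.add_assoc]
  · rw [fromBlocks_zero₂₁_pow_eq, Matrix.fromBlocks_apply₁₂, Matrix.sum_apply,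
      Finset.sum_range_succ', Finset.sum_eq_zero fun i _ => by simp, zero_add, pow_zero,
      Matrix.one_mul, show L + 1 - 1 - 0 = L from by omega, Matrix.mul_apply]
    simp [E, hf]

/-- **Padding**: `d` extra unit edges in front of the source lengthen a program by `d` at the cost
of `d` vertices. [cite: DuttaDwivediSaxena2022, §2.1 remark after Def. 2.5 (full version p0018 L477–478)] -/
theorem UABPComputesLen.pad {S L : ℕ} {f : MvPolynomial (Fin n) F} (hf : UABPComputesLen S L f)
    (d : ℕ) : UABPComputesLen (S + d) (L + d) f := by
  induction d with
  | zero => exact hf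
  | succ d ih => exact ih.pad_one

/-- **Series composition / closure under multiplication** ("ABP is closed under …
multiplication", p0018 L477–478): identify nothing, add one unit edge from the sink of the first
program to the source of the second; vertices add (`S₁ + S₂`), lengths add plus one.
[cite: DuttaDwivediSaxena2022, §2.1 remark after Def. 2.5 (full version p0018 L477–478)] -/
theorem UABPComputesLen.mul {S₁ S₂ L₁ L₂ : ℕ} {f g : MvPolynomial (Fin n) F}
    (hf : UABPComputesLen S₁ L₁ f) (hg : UABPComputesLen S₂ L₂ g) :
    UABPComputesLen (S₁ + S₂) (L₁ + L₂ + 1) (f * g) := by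
  obtain ⟨V₁, hV₁, la₁, s₁, t₁, N₁, hlay₁, hlab₁, hst₁, hf⟩ := hf
  obtain ⟨V₂, hV₂, la₂, s₂, t₂, N₂, hlay₂, hlab₂, hst₂, hg⟩ := hg
  let Q : Matrix (Fin V₁) (Fin V₂) (MvPolynomial (Fin n) F) :=
    Matrix.of fun x y => if x = t₁ then (if y = s₂ then 1 else 0) else 0
  refine UABPComputesLen.of_fintype (ι := Fin V₁ ⊕ Fin V₂) (by simp; omega)
    (Sum.elim (fun u => la₁ u + la₂ s₂) (fun v => la₂ v + la₁ t₁ + 1)) (Sum.inl s₁) (Sum.inr t₂)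
    (Matrix.fromBlocks N₁ Q 0 N₂) ?_ ?_ ?_ ?_
  · rintro (u | u) (v | v) h
    · simp only [Matrix.fromBlocks_apply₁₁] at h
      simp [hlay₁ u v h, Nat.add_right_comm]
    · simp only [Matrix.fromBlocks_apply₁₂, Q, Matrix.of_apply] at h
      split_ifs at h with hu hv
      · subst hu
        subst hv
        simp only [Sum.elim_inl, Sum.elim_inr]
        omega
      · exact absurd rfl h
      · exact absurd rfl h
    · simp at h
    · simp only [Matrix.fromBlocks_apply₂₂] at h
      simp [hlay₂ u v h, Nat.add_right_comm]
  · rintro (u | u) (v | v)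
    · exact ⟨(hlab₁ u v).1, (hlab₁ u v).2.trans (Nat.le_add_right _ _)⟩
    · simp only [Matrix.fromBlocks_apply₁₂, Q, Matrix.of_apply]
      split_ifs <;> simp
    · simp
    · exact ⟨(hlab₂ u v).1, (hlab₂ u v).2.trans (Nat.le_add_left _ _)⟩
  · simp only [Sum.elim_inl, Sum.elim_inr, hst₁, hst₂]
    omega
  · rw [fromBlocks_zero₂₁_pow_eq, Matrix.fromBlocks_apply₁₂, Matrix.sum_apply,
      Finset.sum_eq_single L₁]
    · rw [show L₁ + L₂ + 1 - 1 - L₁ = L₂ from by omega, mul_bridge_mul_apply, hf, hg]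
    · intro i _ hne
      rw [mul_bridge_mul_apply,
        pow_apply_eq_zero_of_layer hlay₁ i s₁ t₁ (by rw [hst₁]; omega), zero_mul]
    · intro h
      exact absurd (Finset.mem_range.2 (by omega)) h

/-- Scaling by a constant: `C c * f` (series composition with the one-edge program for `C c`).
[cite: DuttaDwivediSaxena2022, §2.1 remark after Def. 2.5 (full version p0018 L477–478)] -/
theorem UABPComputesLen.smul_C {S L : ℕ} {f : MvPolynomial (Fin n) F} (hf : UABPComputesLen S L f)
    (c : F) : UABPComputesLen (S + 2) (L + 2) (C c * f) := by
  have h := (UABPComputesLen.of_C (n := n) (S := 2) le_rfl c).mul hf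
  rw [show 2 + S = S + 2 from by omega, show 1 + L + 1 = L + 2 from by omega] at h
  exact h

/-! ## Parallel composition (sums) -/

/-- **Parallel composition / closure under addition** ("ABP is closed under both addition and
multiplication", p0018 L477–478): programs of a COMMON length `L` for the `f i` are put side by
side (block-diagonal body) under a fresh source and a fresh sink joined to every `s i` / from
every `t i` by unit edges; vertices `≤ card ι · S + 2`, length `L + 2`.
[cite: DuttaDwivediSaxena2022, §2.1 remark after Def. 2.5 (full version p0018 L477–478)] -/
theorem UABPComputesLen.sum {ι : Type*} [Fintype ι] [DecidableEq ι] {S L : ℕ}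
    (f : ι → MvPolynomial (Fin n) F) (h : ∀ i, UABPComputesLen S L (f i)) :
    UABPComputesLen (Fintype.card ι * S + 2) (L + 2) (∑ i, f i) := by
  choose V hV layer s t N hlay hlab hst hf using h
  have hσ : ∀ i, layer i (s i) ≤ ∑ j, layer j (s j) := fun i =>
    Finset.single_le_sum (f := fun j => layer j (s j)) (fun j _ => Nat.zero_le _)
      (Finset.mem_univ i)
  let a : (Σ i, Fin (V i)) → MvPolynomial (Fin n) F := fun x => if x.2 = s x.1 then 1 else 0
  let b : (Σ i, Fin (V i)) → MvPolynomial (Fin n) F := fun x => if x.2 = t x.1 then 1 else 0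
  let lay : Fin 2 ⊕ (Σ i, Fin (V i)) → ℕ :=
    Sum.elim (fun j => if j = 0 then ∑ j, layer j (s j) else (∑ j, layer j (s j)) + L + 2)
      (fun x => layer x.1 x.2 + 1 + ((∑ j, layer j (s j)) - layer x.1 (s x.1)))
  refine UABPComputesLen.of_fintype (ι := Fin 2 ⊕ Σ i, Fin (V i)) ?_ lay (Sum.inl 0) (Sum.inl 1)
    (srcSnk a b (Matrix.blockDiagonal' N)) ?_ ?_ ?_ ?_
  · simp only [Fintype.card_sum, Fintype.card_fin, Fintype.card_sigma]
    have : ∑ i, V i ≤ ∑ _i : ι, S := Finset.sum_le_sum fun i _ => hV i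
    rw [Finset.sum_const, Finset.card_univ, smul_eq_mul] at this
    omega
  · rintro (j | ⟨i, u⟩) (j' | ⟨i', v⟩) h
    · simp at h
    · simp only [srcSnk_inl_inr, a] at h
      split_ifs at h with hj hv
      · subst hj
        have := hσ i'
        simp only [lay, Sum.elim_inl, Sum.elim_inr, Fin.isValue, if_true, hv]
        omega
      · exact absurd rfl h
      · exact absurd rfl h
    · simp only [srcSnk_inr_inl, b] at h
      split_ifs at h with hj hu
      · subst hj
        have := hσ i
        simp only [lay, Sum.elim_inl, Sum.elim_inr, Fin.isValue, one_ne_zero, if_false, hu, hst i]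
        omega
      · exact absurd rfl h
      · exact absurd rfl h
    · simp only [srcSnk_inr_inr, Matrix.blockDiagonal'_apply'] at h
      by_cases hii : i = i'
      · subst hii
        simp only [cast_eq, ne_eq] at h
        simp only [lay, Sum.elim_inr, hlay i u v h]
        omega
      · simp [hii] at h
  · rintro (j | ⟨i, u⟩) (j' | ⟨i', v⟩)
    · simp
    · simp only [srcSnk_inl_inr, a]
      split_ifs <;> simp
    · simp only [srcSnk_inr_inl, b]
      split_ifs <;> simp
    · simp only [srcSnk_inr_inr, Matrix.blockDiagonal'_apply']
      by_cases hii : i = i'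
      · subst hii
        simp only [cast_eq]
        refine ⟨(hlab i u v).1, (hlab i u v).2.trans ?_⟩
        have : 1 ≤ Fintype.card ι := Fintype.card_pos_iff.2 ⟨i⟩
        nlinarith
      · simp [hii]
  · simp only [lay, Sum.elim_inl, Fin.isValue, if_true, one_ne_zero, if_false]
    omega
  · rw [srcSnk_pow_src_snk, ← Matrix.blockDiagonal'_pow, sum_bridge_blockDiagonal']
    exact Finset.sum_congr rfl fun i _ => by rw [Pi.pow_apply, hf i]

/-- Binary addition of programs of a common length (the case `ι = Fin 2` of `sum`).
[cite: DuttaDwivediSaxena2022, §2.1 remark after Def. 2.5 (full version p0018 L477–478)] -/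
theorem UABPComputesLen.add {S L : ℕ} {f g : MvPolynomial (Fin n) F}
    (hf : UABPComputesLen S L f) (hg : UABPComputesLen S L g) :
    UABPComputesLen (2 * S + 2) (L + 2) (f + g) := by
  have h := UABPComputesLen.sum ![f, g] (fun i => by fin_cases i <;> assumption)
  simpa [Fin.sum_univ_two] using h

/-- Binary addition of programs of arbitrary budgets and lengths (pad both to the longer length,
enlarge both budgets to a common one, then `add`).
[cite: DuttaDwivediSaxena2022, §2.1 remark after Def. 2.5 (full version p0018 L477–478)] -/
theorem UABPComputesLen.add' {S₁ S₂ L₁ L₂ : ℕ} {f g : MvPolynomial (Fin n) F}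
    (hf : UABPComputesLen S₁ L₁ f) (hg : UABPComputesLen S₂ L₂ g) :
    UABPComputesLen (2 * (S₁ + S₂ + L₁ + L₂) + 2) (max L₁ L₂ + 2) (f + g) := by
  have hf' : UABPComputesLen (S₁ + S₂ + L₁ + L₂) (max L₁ L₂) f := by
    have h := hf.pad (max L₁ L₂ - L₁)
    rw [show L₁ + (max L₁ L₂ - L₁) = max L₁ L₂ from by omega] at h
    exact h.mono (by omega)
  have hg' : UABPComputesLen (S₁ + S₂ + L₁ + L₂) (max L₁ L₂) g := by
    have h := hg.pad (max L₁ L₂ - L₂)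
    rw [show L₂ + (max L₁ L₂ - L₂) = max L₁ L₂ from by omega] at h
    exact h.mono (by omega)
  exact hf'.add hg'

/-! ## Iterated products -/

/-- **Iterated series composition**: a product over a finset of programs within a common budget
`S` and of a common length `L` (budget `2 + card · S`, length `1 + card · (L + 1)`; the empty
product is the one-edge program for `C 1`).
[cite: DuttaDwivediSaxena2022, §2.1 remark after Def. 2.5 (full version p0018 L477–478)] -/
theorem UABPComputesLen.prod {ι : Type*} [DecidableEq ι] {S L : ℕ}
    (f : ι → MvPolynomial (Fin n) F) (s : Finset ι) (h : ∀ i ∈ s, UABPComputesLen S L (f i)) :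
    UABPComputesLen (2 + s.card * S) (1 + s.card * (L + 1)) (∏ i ∈ s, f i) := by
  induction s using Finset.induction_on with
  | empty => simpa using UABPComputesLen.of_C (n := n) (S := 2) le_rfl (1 : F)
  | insert a s ha ih =>
    rw [Finset.prod_insert ha, Finset.card_insert_of_notMem ha]
    have h1 := (h a (Finset.mem_insert_self a s)).mul
      (ih fun i hi => h i (Finset.mem_insert_of_mem hi))
    have e1 : 2 + (s.card + 1) * S = S + (2 + s.card * S) := by ring
    have e2 : 1 + (s.card + 1) * (L + 1) = L + (1 + s.card * (L + 1)) + 1 := by ring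
    rw [e1, e2]
    exact h1

end Toolkit

section Ring

variable {F : Type*} [CommRing F] {n : ℕ}

/-- Negation (`= C (-1) * f`). [cite: DuttaDwivediSaxena2022, §2.1 remark after Def. 2.5 (full version p0018 L477–478)] -/
theorem UABPComputesLen.neg {S L : ℕ} {f : MvPolynomial (Fin n) F} (hf : UABPComputesLen S L f) :
    UABPComputesLen (S + 2) (L + 2) (-f) := by
  have h := hf.smul_C (-1)
  rwa [C_neg, C_1, neg_one_mul] at h

/-- Subtraction of programs of a common budget and length.
[cite: DuttaDwivediSaxena2022, §2.1 remark after Def. 2.5 (full version p0018 L477–478)] -/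
theorem UABPComputesLen.sub {S L : ℕ} {f g : MvPolynomial (Fin n) F} (hf : UABPComputesLen S L f)
    (hg : UABPComputesLen S L g) : UABPComputesLen (2 * (S + 2) + 2) (L + 4) (f - g) := by
  have h := ((hf.pad 2).mono (show S + 2 ≤ S + 2 from le_rfl)).add hg.neg
  rwa [← sub_eq_add_neg] at h

end Ring

/-! ## Layer 2: powers, sums of programs of unequal lengths, linear combinations, truncated
geometric series, affine univariate substitutions (partial evaluation)

These are the ABP manipulations of DDS Lemma 2.6 / Claim 3.7 (p0018 L481–498, p0034 L901–913):
"ABPs are closed under multiplication, which makes interpolation, with respect to `y`, possible.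
Interpolating the coefficient `C_i`, of `y^i`, gives a sum of `d` ABP[s]" (a coefficient of `y^i`
is an `F`-linear combination of partial evaluations `y := a_k` — `sum_smul_C` of `eval_var`
instances), and "the inverse identity: `1/(1−z) ≡ 1 + … + z^{d−1} mod z^d`" (`geom_sum`). -/

section Layer2

variable {F : Type*} [CommSemiring F] {n : ℕ}

/-- Powers: `f ^ e` by `e`-fold series composition (`prod` over `Fin e`).
[cite: DuttaDwivediSaxena2022, §2.1 remark after Def. 2.5 (full version p0018 L477–478)] -/
theorem UABPComputesLen.pow {S L : ℕ} {f : MvPolynomial (Fin n) F} (hf : UABPComputesLen S L f)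
    (e : ℕ) : UABPComputesLen (2 + e * S) (1 + e * (L + 1)) (f ^ e) := by
  classical
  have h := UABPComputesLen.prod (fun _ : Fin e => f) Finset.univ (fun _ _ => hf)
  simpa [Finset.prod_const, Finset.card_univ, Fintype.card_fin] using h

/-- Parallel composition of programs of UNEQUAL lengths `L i ≤ Lmax` (pad each to `Lmax` first;
budget `card ι · (S + Lmax) + 2`, length `Lmax + 2`).
[cite: DuttaDwivediSaxena2022, §2.1 remark after Def. 2.5 (full version p0018 L477–478)] -/
theorem UABPComputesLen.sum_le {ι : Type*} [Fintype ι] [DecidableEq ι] {S Lmax : ℕ}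
    (f : ι → MvPolynomial (Fin n) F) (L : ι → ℕ) (hL : ∀ i, L i ≤ Lmax)
    (h : ∀ i, UABPComputesLen S (L i) (f i)) :
    UABPComputesLen (Fintype.card ι * (S + Lmax) + 2) (Lmax + 2) (∑ i, f i) :=
  UABPComputesLen.sum f fun i => by
    have h1 := (h i).pad (Lmax - L i)
    have h2 := hL i
    rw [show L i + (Lmax - L i) = Lmax from by omega] at h1
    exact h1.mono (by omega)

/-- `F`-linear combinations `∑ i, C (c i) * f i` of programs of a common budget and length (the
shape of an interpolation formula, DDS Lemma 2.6 proof).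
[cite: DuttaDwivediSaxena2022, Lemma 2.6 proof (full version p0018 L486–488)] -/
theorem UABPComputesLen.sum_smul_C {ι : Type*} [Fintype ι] [DecidableEq ι] {S L : ℕ} (c : ι → F)
    (f : ι → MvPolynomial (Fin n) F) (h : ∀ i, UABPComputesLen S L (f i)) :
    UABPComputesLen (Fintype.card ι * (S + 2) + 2) (L + 4) (∑ i, C (c i) * f i) :=
  UABPComputesLen.sum _ fun i => (h i).smul_C (c i)

/-- **Truncated geometric series** `∑_{i<D} g^i` (the right-hand side of "the inverse identity
`1/(1−z) ≡ 1 + … + z^{D−1} mod z^D`" used to invert an ABP denominator with unit constant term,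
DDS Claim 3.7 proof / Lemma 2.6): an explicit polynomial budget in `(S, L, D)`.
[cite: DuttaDwivediSaxena2022, Claim 3.7 proof (full version p0034 L906–913) and Lemma 2.6 (p0018 L481–498)] -/
theorem UABPComputesLen.geom_sum {S L : ℕ} {g : MvPolynomial (Fin n) F} (hg : UABPComputesLen S L g)
    (D : ℕ) :
    UABPComputesLen (D * ((2 + D * S) + (1 + D * (L + 1))) + 2) ((1 + D * (L + 1)) + 2)
      (∑ i ∈ Finset.range D, g ^ i) := by
  classical
  rw [Finset.sum_range]
  have h := UABPComputesLen.sum_le (ι := Fin D) (S := 2 + D * S) (Lmax := 1 + D * (L + 1))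
    (fun i => g ^ (i : ℕ)) (fun i => 1 + (i : ℕ) * (L + 1))
    (fun i => by have := i.isLt; nlinarith) fun i => (hg.pow i).mono (by have := i.isLt; nlinarith)
  simpa [Fintype.card_fin] using h

/-- Substituting affine univariate forms does not raise the total degree (a commutative-semiring
copy, kept private, of `Literature.Combinatorics.Extremal.totalDegree_aeval_le_of_le_one`).
[folklore] -/
private theorem totalDegree_bind₁_le_of_le_one {σ τ : Type*} (φ : σ → MvPolynomial τ F)
    (hφ : ∀ i, (φ i).totalDegree ≤ 1) (f : MvPolynomial σ F) :
    (bind₁ φ f).totalDegree ≤ f.totalDegree := by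
  classical
  conv_lhs => rw [f.as_sum]
  rw [map_sum]
  refine (totalDegree_finsetSum _ _).trans (Finset.sup_le fun e he => ?_)
  rw [bind₁_monomial]
  refine (totalDegree_mul _ _).trans ?_
  rw [totalDegree_C, zero_add]
  refine (totalDegree_finsetProd _ _).trans ?_
  refine le_trans (Finset.sum_le_sum fun i _ => (totalDegree_pow _ _).trans
    (Nat.mul_le_mul_left _ (hφ i))) ?_
  simpa [Finsupp.sum] using le_totalDegree he

/-- Substituting polynomials with at most one variable each into a polynomial with at most one
variable yields a polynomial with at most one variable. [folklore] -/
private theorem card_vars_bind₁_le_one {σ τ : Type*} [DecidableEq τ] (φ : σ → MvPolynomial τ F)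
    (hφ : ∀ i, (φ i).vars.card ≤ 1) (p : MvPolynomial σ F) (hp : p.vars.card ≤ 1) :
    (bind₁ φ p).vars.card ≤ 1 := by
  classical
  refine (Finset.card_le_card (vars_bind₁ φ p)).trans (Finset.card_biUnion_le.trans ?_)
  calc ∑ i ∈ p.vars, (φ i).vars.card ≤ ∑ _i ∈ p.vars, 1 := Finset.sum_le_sum fun i _ => hφ i
    _ = p.vars.card := by simp
    _ ≤ 1 := hp

/-- `X i` involves at most one variable (also over the trivial ring). [folklore] -/
private theorem card_vars_X_le_one {σ : Type*} (i : σ) :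
    (X i : MvPolynomial σ F).vars.card ≤ 1 := by
  classical
  rcases subsingleton_or_nontrivial F with hF | hF
  · have h0 : (X i : MvPolynomial σ F) = 0 := by
      rw [← one_mul (X i), ← C_1, Subsingleton.elim (1 : F) 0, C_0, zero_mul]
    simp [h0]
  · simp [vars_X]

/-- `X i` has total degree at most one (also over the trivial ring). [folklore] -/
private theorem totalDegree_X_le_one {σ : Type*} (i : σ) :
    (X i : MvPolynomial σ F).totalDegree ≤ 1 := by
  rcases subsingleton_or_nontrivial F with hF | hF
  · have h0 : (X i : MvPolynomial σ F) = 0 := by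
      rw [← one_mul (X i), ← C_1, Subsingleton.elim (1 : F) 0, C_0, zero_mul]
    simp [h0]
  · simp [totalDegree_X]

/-- **Affine univariate substitutions** `x_j ↦ φ j` (each `φ j` involving at most one variable and
of degree `≤ 1`: partial evaluations `x_j := c`, shifts `x_j + α_j`, dilations `c · x_j`,
renamings) act label-by-label on a program: same vertices, same layers, same length, labels stay
univariate of degree `≤ S`. This is the ABP side of "interpolation with respect to `y`" (DDS
Lemma 2.6 proof) and of the evaluation `z = 0` of Claim 3.8.
[cite: DuttaDwivediSaxena2022, Lemma 2.6 proof (full version p0018 L486–498)] -/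
theorem UABPComputesLen.bind₁_affine {S L : ℕ} {f : MvPolynomial (Fin n) F}
    (hf : UABPComputesLen S L f) (φ : Fin n → MvPolynomial (Fin n) F)
    (hvars : ∀ j, (φ j).vars.card ≤ 1) (hdeg : ∀ j, (φ j).totalDegree ≤ 1) :
    UABPComputesLen S L (bind₁ φ f) := by
  obtain ⟨V, hV, layer, s, t, N, hlay, hlab, hst, hf⟩ := hf
  refine ⟨V, hV, layer, s, t, N.map (bind₁ φ), ?_, ?_, hst, ?_⟩
  · intro u v h
    exact hlay u v fun h0 => h (by rw [Matrix.map_apply, h0, map_zero])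
  · intro u v
    exact ⟨card_vars_bind₁_le_one φ hvars _ (hlab u v).1,
      (totalDegree_bind₁_le_of_le_one φ hdeg _).trans (hlab u v).2⟩
  · have hpow : (N.map (bind₁ φ)) ^ L = (N ^ L).map (bind₁ φ) := by
      have h := ((bind₁ φ).toRingHom.mapMatrix (m := Fin V)).map_pow N L
      simpa [RingHom.mapMatrix_apply] using h.symm
    rw [hpow, Matrix.map_apply, hf]

/-- **Partial evaluation** `x_j := c` of a program (the instances summed by an interpolation
formula, DDS Lemma 2.6 proof; and "`|_{z=0}`" of Claim 3.8): same budget, same length.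
[cite: DuttaDwivediSaxena2022, Lemma 2.6 proof (full version p0018 L486–498)] -/
theorem UABPComputesLen.eval_var {S L : ℕ} {f : MvPolynomial (Fin n) F}
    (hf : UABPComputesLen S L f) (j : Fin n) (c : F) :
    UABPComputesLen S L (bind₁ (Function.update X j (C c)) f) := by
  classical
  refine hf.bind₁_affine _ (fun i => ?_) (fun i => ?_)
  · rcases eq_or_ne i j with rfl | h
    · simp [vars_C]
    · simpa [Function.update, h] using card_vars_X_le_one (F := F) i
  · rcases eq_or_ne i j with rfl | h
    · simp
    · simpa [Function.update, h] using totalDegree_X_le_one (F := F) i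

end Layer2

/-! ## Layer 3: degree truncation (homogeneous components)

The last step of DDS Lemma 2.6 (Strassen's division elimination for ABPs, p0018 L489–498) works
"mod `⟨x, y⟩^d`": after the shift and the truncated inverse identity one keeps the part of degree
`< d` of a polynomial computed by an ABP. For ABPs with univariate labels this truncation is the
DEGREE-GRADED COPY construction: vertices `(v, a)` = "at `v` with accumulated degree `a ≤ D`",
the edge `(u, a) → (v, b)` carrying the degree-`(b − a)` homogeneous component of the label
`N u v`; formally the label matrix is `N` with every entry replaced by its truncated Toeplitz
matrix `(a, b) ↦ [a ≤ b] · (N u v)_{b−a}`, and `p ↦ Toeplitz(p)` is a ring homomorphism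
(`toeplitzRingHom`), so powers are computed blockwise. -/

section Layer3

variable {F : Type*} [CommSemiring F] {n : ℕ}

/-- The homogeneous components of a product (Cauchy product formula):
`(p q)_k = ∑_{i ≤ k} p_i q_{k−i}`. [folklore] -/
private theorem homogeneousComponent_mul_eq_sum {σ : Type*} (k : ℕ) (p q : MvPolynomial σ F) :
    homogeneousComponent k (p * q) =
      ∑ i ∈ Finset.range (k + 1), homogeneousComponent i p * homogeneousComponent (k - i) q := by
  classical
  ext d
  rw [coeff_homogeneousComponent, coeff_sum]
  simp_rw [coeff_mul, coeff_homogeneousComponent]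
  rw [Finset.sum_comm]
  split_ifs with hd
  · refine Finset.sum_congr rfl fun x hx => ?_
    have hx' : x.1 + x.2 = d := by simpa using hx
    have hdeg : x.1.degree + x.2.degree = k := by rw [← map_add, hx', hd]
    rw [Finset.sum_eq_single_of_mem x.1.degree (Finset.mem_range.2 (by omega))]
    · rw [if_pos rfl, if_pos (by omega)]
    · intro i _ hi
      rw [if_neg (Ne.symm hi), zero_mul]
  · refine (Finset.sum_eq_zero fun x hx => Finset.sum_eq_zero fun i hi => ?_).symm
    have hx' : x.1 + x.2 = d := by simpa using hx
    have hi' := Finset.mem_range.1 hi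
    by_cases h1 : x.1.degree = i
    · by_cases h2 : x.2.degree = k - i
      · exfalso
        apply hd
        rw [← hx', map_add, h1, h2]
        omega
      · rw [if_neg h2, mul_zero]
    · rw [if_neg h1, zero_mul]

/-- A homogeneous component involves no new variables. [folklore] -/
private theorem card_vars_homogeneousComponent_le {σ : Type*} (e : ℕ) (p : MvPolynomial σ F)
    (hp : p.vars.card ≤ 1) : (homogeneousComponent e p).vars.card ≤ 1 := by
  classical
  refine (Finset.card_le_card fun i hi => ?_).trans hp
  rw [mem_vars_iff_mem_support] at hi ⊢
  obtain ⟨d, hd, hid⟩ := hi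
  refine ⟨d, ?_, hid⟩
  rw [mem_support_iff, coeff_homogeneousComponent] at hd
  rw [mem_support_iff]
  intro h0
  exact hd (by simp [h0])

/-- A homogeneous component does not raise the total degree. [folklore] -/
private theorem totalDegree_homogeneousComponent_le {σ : Type*} (e : ℕ) (p : MvPolynomial σ F) :
    (homogeneousComponent e p).totalDegree ≤ p.totalDegree := by
  by_cases h0 : homogeneousComponent e p = 0
  · simp [h0]
  · have he : e ≤ p.totalDegree := not_lt.1 fun hlt => h0 (homogeneousComponent_eq_zero _ _ hlt)
    exact (homogeneousComponent_isHomogeneous e p).totalDegree_le.trans he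

/-- The truncated Toeplitz matrix of a polynomial: `(a, b) ↦ [a ≤ b] · p_{b−a}` on
`Fin (D+1) × Fin (D+1)` (degree bookkeeping of the graded copy). [folklore] -/
private noncomputable def toeplitz (D : ℕ) (p : MvPolynomial (Fin n) F) :
    Matrix (Fin (D + 1)) (Fin (D + 1)) (MvPolynomial (Fin n) F) :=
  Matrix.of fun a b => if (a : ℕ) ≤ b then homogeneousComponent ((b : ℕ) - a) p else 0

/-- Entries of `toeplitz`. [folklore] -/
private theorem toeplitz_apply (D : ℕ) (p : MvPolynomial (Fin n) F) (a b : Fin (D + 1)) :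
    toeplitz D p a b = if (a : ℕ) ≤ b then homogeneousComponent ((b : ℕ) - a) p else 0 := rfl

/-- `toeplitz D 1 = 1`. [folklore] -/
private theorem toeplitz_one (D : ℕ) : toeplitz D (1 : MvPolynomial (Fin n) F) = 1 := by
  refine Matrix.ext fun a b => ?_
  rw [toeplitz_apply, Matrix.one_apply]
  have h1 : ∀ m : ℕ, homogeneousComponent m (1 : MvPolynomial (Fin n) F) =
      if m = 0 then 1 else 0 := fun m => by
    rw [← C_1, homogeneousComponent_of_mem ((mem_homogeneousSubmodule _ _).2
      (isHomogeneous_C _ _))]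
  by_cases hab : a = b
  · subst hab
    simp [h1]
  · have hne : (a : ℕ) ≠ b := fun h => hab (Fin.ext h)
    rw [if_neg hab]
    split_ifs with hle
    · rw [h1, if_neg (by omega)]
    · rfl

/-- `toeplitz D (p * q) = toeplitz D p * toeplitz D q` (the Cauchy product, truncated).
[folklore] -/
private theorem toeplitz_mul (D : ℕ) (p q : MvPolynomial (Fin n) F) :
    toeplitz D (p * q) = toeplitz D p * toeplitz D q := by
  refine Matrix.ext fun a b => ?_
  rw [Matrix.mul_apply, toeplitz_apply]
  simp only [toeplitz_apply]
  by_cases hab : (a : ℕ) ≤ b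
  · rw [if_pos hab, homogeneousComponent_mul_eq_sum]
    -- reindex the sum over `c : Fin (D+1)` with `a ≤ c ≤ b` by `i = c - a`
    rw [Fin.sum_univ_eq_sum_range (fun c : ℕ =>
      (if (a : ℕ) ≤ c then homogeneousComponent (c - a) p else 0) *
        (if c ≤ (b : ℕ) then homogeneousComponent ((b : ℕ) - c) q else 0)) (D + 1)]
    have key : ∀ c ∈ Finset.range (D + 1),
        (if (a : ℕ) ≤ c then homogeneousComponent (c - a) p else 0) *
          (if c ≤ (b : ℕ) then homogeneousComponent ((b : ℕ) - c) q else 0) =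
        if c ∈ Finset.Ico (a : ℕ) (b + 1) then
          homogeneousComponent (c - a) p * homogeneousComponent ((b : ℕ) - c) q else 0 := by
      intro c _
      by_cases h1 : (a : ℕ) ≤ c
      · by_cases h2 : c ≤ (b : ℕ)
        · rw [if_pos h1, if_pos h2, if_pos (Finset.mem_Ico.2 ⟨h1, by omega⟩)]
        · rw [if_pos h1, if_neg h2, mul_zero,
            if_neg fun h => h2 (by have := (Finset.mem_Ico.1 h).2; omega)]
      · rw [if_neg h1, zero_mul, if_neg fun h => h1 (Finset.mem_Ico.1 h).1]
    rw [Finset.sum_congr rfl key, Finset.sum_ite_mem]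
    have hfilter : Finset.range (D + 1) ∩ Finset.Ico (a : ℕ) (b + 1) = Finset.Ico (a : ℕ) (b + 1) := by
      ext c
      simp only [Finset.mem_inter, Finset.mem_range, Finset.mem_Ico]
      have := b.isLt
      omega
    rw [hfilter, Finset.sum_Ico_eq_sum_range, show (b : ℕ) + 1 - a = (b : ℕ) - a + 1 from by omega]
    refine Finset.sum_congr rfl fun i hi => ?_
    rw [Finset.mem_range] at hi
    rw [show (a : ℕ) + i - a = i from by omega, show (b : ℕ) - (a + i) = (b : ℕ) - a - i from by omega]
  · rw [if_neg hab]
    symm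
    refine Finset.sum_eq_zero fun c _ => ?_
    by_cases h1 : (a : ℕ) ≤ c
    · rw [if_neg (show ¬ ((c : ℕ) ≤ b) from by omega), mul_zero]
    · rw [if_neg h1, zero_mul]

/-- `p ↦ toeplitz D p` as a ring homomorphism. [folklore] -/
private noncomputable def toeplitzRingHom (D : ℕ) :
    MvPolynomial (Fin n) F →+* Matrix (Fin (D + 1)) (Fin (D + 1)) (MvPolynomial (Fin n) F) where
  toFun := toeplitz D
  map_one' := toeplitz_one D
  map_mul' := toeplitz_mul D
  map_zero' := by
    refine Matrix.ext fun a b => ?_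
    simp [toeplitz_apply]
  map_add' p q := by
    refine Matrix.ext fun a b => ?_
    simp only [toeplitz_apply, Matrix.add_apply]
    split_ifs <;> simp

/-- **Homogeneous components of an ABP-computed polynomial** (the degree-graded copy:
`(D+1)`-fold vertex blow-up, same length): for `k ≤ D`, `f_k` is computed within budget
`S · (D + 1)`. This is the ABP side of working "mod `⟨x, y⟩^d`" in DDS Lemma 2.6 (Strassen's
division elimination). [cite: DuttaDwivediSaxena2022, Lemma 2.6 and its proof (full version p0018 L481–498)] -/
theorem UABPComputesLen.homogeneousComponent {S L : ℕ} {f : MvPolynomial (Fin n) F}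
    (hf : UABPComputesLen S L f) {D k : ℕ} (hk : k ≤ D) :
    UABPComputesLen (S * (D + 1)) L (homogeneousComponent k f) := by
  obtain ⟨V, hV, layer, s, t, N, hlay, hlab, hst, hf⟩ := hf
  refine UABPComputesLen.of_fintype (ι := Fin V × Fin (D + 1))
    (by simpa using Nat.mul_le_mul_right (D + 1) hV)
    (fun x => layer x.1) (s, 0) (t, ⟨k, by omega⟩)
    (Matrix.comp _ _ _ _ _ ((toeplitzRingHom D).mapMatrix N)) ?_ ?_ hst ?_
  · rintro ⟨u, a⟩ ⟨v, b⟩ h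
    refine hlay u v fun h0 => h ?_
    simp [RingHom.mapMatrix_apply, toeplitzRingHom, toeplitz_apply, h0]
  · rintro ⟨u, a⟩ ⟨v, b⟩
    simp only [Matrix.comp_apply, RingHom.mapMatrix_apply, Matrix.map_apply]
    show ((toeplitz D (N u v)) a b).vars.card ≤ 1 ∧ ((toeplitz D (N u v)) a b).totalDegree ≤ _
    rw [toeplitz_apply]
    split_ifs
    · exact ⟨card_vars_homogeneousComponent_le _ _ (hlab u v).1,
        (totalDegree_homogeneousComponent_le _ _).trans
          ((hlab u v).2.trans (Nat.le_mul_of_pos_right S (Nat.succ_pos D)))⟩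
    · simp
  · rw [← Matrix.compRingEquiv_apply, ← map_pow, ← map_pow, Matrix.compRingEquiv_apply,
      Matrix.comp_apply, RingHom.mapMatrix_apply, Matrix.map_apply, hf]
    show toeplitz D f 0 ⟨k, _⟩ = _
    rw [toeplitz_apply]
    simp

/-- **Degree truncation** `f mod (degree > D) = ∑_{k ≤ D} f_k` of an ABP-computed polynomial
(parallel composition of the `D + 1` graded copies; budget `(D+1) · S · (D+1) + 2`, length
`L + 2`) — the "mod `⟨x, y⟩^d`" step of DDS Lemma 2.6.
[cite: DuttaDwivediSaxena2022, Lemma 2.6 and its proof (full version p0018 L481–498)] -/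
theorem UABPComputesLen.truncate {S L : ℕ} {f : MvPolynomial (Fin n) F}
    (hf : UABPComputesLen S L f) (D : ℕ) :
    UABPComputesLen ((D + 1) * (S * (D + 1)) + 2) (L + 2)
      (∑ k ∈ Finset.range (D + 1), MvPolynomial.homogeneousComponent k f) := by
  classical
  rw [Finset.sum_range]
  have h := UABPComputesLen.sum (ι := Fin (D + 1))
    (fun k => MvPolynomial.homogeneousComponent (k : ℕ) f)
    fun k => hf.homogeneousComponent (D := D) (k := k) (by have := k.isLt; omega)
  simpa [Fintype.card_fin] using h

end Layer3

/-! ## Layer 4: depth-3 circuits have small ABPs; the `k = 1` base of Thm. 3.2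

"The `k = 1` case is obvious, as `\overline{ΠΣ} = ΠΣ` and trivially it has a small ABP" (DDS §3,
proof of Thm. 3.2, p0026 L716). With the tree's `DDS2021_lemma_2_21_piSigma_holds`
(`DDS21PiSigmaClosedProofs.lean`) and the toolkit: an affine form is the parallel composition of
`n + 1` one-edge programs, a `Σ^{[k]}Π^{[d]}Σ` circuit (`MS2021.IsSPS`, = `spsClass`) is a sum of
products of those, and the `k = 1` case of `DDS2021_thm_3_2` follows with the explicit exponent
`5` in place of the unnamed constant. -/

section Layer4

variable {F : Type*} [CommSemiring F] {n : ℕ}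

/-- **Affine forms** `a₀ + ∑_m a_m x_m`: parallel composition of the `n + 1` one-edge programs for
`C a₀` and the `C (a m) * X m` (budget `(n+1)·2 + 2`, length `3`).
[cite: DuttaDwivediSaxena2022, Def. 2.5 and §2.1 remark (full version p0017 L468 – p0018 L478)] -/
theorem UABPComputesLen.of_affine (a₀ : F) (a : Fin n → F) :
    UABPComputesLen ((n + 1) * 2 + 2) 3 (C a₀ + ∑ m, C (a m) * X m : MvPolynomial (Fin n) F) := by
  classical
  let g : Option (Fin n) → MvPolynomial (Fin n) F := fun o => Option.elim o (C a₀) fun m => C (a m) * X m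
  have hg : ∀ o, UABPComputesLen 2 1 (g o) := by
    rintro (_ | m)
    · exact UABPComputesLen.of_C le_rfl a₀
    · refine UABPComputesLen.of_label le_rfl _ ?_ ?_
      · refine (Finset.card_le_card (vars_mul _ _)).trans ?_
        rw [vars_C, Finset.empty_union]
        exact card_vars_X_le_one (F := F) m
      · exact (totalDegree_mul _ _).trans (by
          rw [totalDegree_C, zero_add]; exact (totalDegree_X_le_one (F := F) m).trans one_le_two)
  have h := UABPComputesLen.sum g hg
  simpa [g, Fintype.card_option, Fintype.sum_option] using h

variable {K : Type*} [Field K]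

/-- **`Σ^{[k]}Π^{[d]}Σ` circuits have small ABPs** ("trivially it has a small ABP", p0026 L716):
`MS2021.IsSPS k d f` ⇒ an ABP within budget `k · (2 + d · (2n + 4)) + 2`, of length `4 d + 3`
(sum of `k` products of `d` affine-form programs).
[cite: DuttaDwivediSaxena2022, §3 proof of Thm. 3.2, `k = 1` case (full version p0026 L716)] -/
theorem UABPComputesLen.of_isSPS {n k d : ℕ} {f : MvPolynomial (Fin n) K} (hf : MS2021.IsSPS k d f) :
    UABPComputesLen (k * (2 + d * ((n + 1) * 2 + 2)) + 2) (1 + d * (3 + 1) + 2) f := by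
  classical
  obtain ⟨α, rfl⟩ := hf
  have hprod : ∀ i : Fin k, UABPComputesLen (2 + d * ((n + 1) * 2 + 2)) (1 + d * (3 + 1))
      (∏ j : Fin d, (C (α i j none) + ∑ m : Fin n, C (α i j (some m)) * X m)) := fun i => by
    have h := UABPComputesLen.prod
      (fun j : Fin d => (C (α i j none) + ∑ m : Fin n, C (α i j (some m)) * X m :
        MvPolynomial (Fin n) K)) Finset.univ
      (fun j _ => UABPComputesLen.of_affine (α i j none) fun m => α i j (some m))
    simpa [Finset.card_univ, Fintype.card_fin] using h
  have h := UABPComputesLen.sum _ hprod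
  simpa [Fintype.card_fin] using h

/-- **`Σ∧Σ` circuits have small ABPs**, directly (no duality detour): each term
`c · ℓ^{e_i}` is `of_affine → pow → smul_C`, the `t` terms (of unequal lengths, `e_i ≤ e`) are
summed by `sum_le`; budget `t · (e·(2n+4) + 4e + 7) + 2`, length `4e + 5`. (The class is DDS
§2.3's `swsClass K n t e`; DDS route `Σ∧Σ ⊆ ARO ⊆ ABP` through Lemma 2.23 is needed for the
BORDER, not for this plain containment.)
[cite: DuttaDwivediSaxena2022, §2.3 (full version p0020 L537–540) with §2.1 remark after Def. 2.5 (p0018 L477–478)] -/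
theorem UABPComputesLen.of_mem_swsClass {n t e : ℕ} {f : MvPolynomial (Fin n) K}
    (hf : f ∈ swsClass K n t e) :
    UABPComputesLen (t * ((e * ((n + 1) * 2 + 2) + 4) + (e * 4 + 3)) + 2) (e * 4 + 3 + 2) f := by
  classical
  obtain ⟨c, α, ex, hex, rfl⟩ := hf
  have h := UABPComputesLen.sum_le (S := e * ((n + 1) * 2 + 2) + 4) (Lmax := e * 4 + 3)
    (fun i : Fin t => (C (c i) * (C (α i none) + ∑ m, C (α i (some m)) * X m) ^ ex i :
      MvPolynomial (Fin n) K)) (fun i => 1 + ex i * (3 + 1) + 2)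
    (fun i => by have := hex i; omega) fun i => by
      have h := ((UABPComputesLen.of_affine (α i none) fun m => α i (some m)).pow (ex i)).smul_C
        (c i)
      refine h.mono ?_
      have := hex i
      nlinarith
  simpa [Fintype.card_fin] using h

/-- `Σ∧Σ ⊆ ABP` in the tree's currency. [cite: DuttaDwivediSaxena2022, §2.3 (full version p0020 L537–540) with §2.1 remark after Def. 2.5 (p0018 L477–478)] -/
theorem uabpComputes_of_mem_swsClass {n t e : ℕ} {f : MvPolynomial (Fin n) K}
    (hf : f ∈ swsClass K n t e) :
    UABPComputes (t * ((e * ((n + 1) * 2 + 2) + 4) + (e * 4 + 3)) + 2) f :=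
  (UABPComputesLen.of_mem_swsClass hf).uabpComputes

/-- The same in the tree's class vocabulary: `f ∈ spsClass K n k d ⇒ UABPComputes … f`.
[cite: DuttaDwivediSaxena2022, §3 proof of Thm. 3.2, `k = 1` case (full version p0026 L716)] -/
theorem uabpComputes_of_mem_spsClass {n k d : ℕ} {f : MvPolynomial (Fin n) K}
    (hf : f ∈ spsClass K n k d) : UABPComputes (k * (2 + d * ((n + 1) * 2 + 2)) + 2) f :=
  (UABPComputesLen.of_isSPS hf).uabpComputes

/-- **The `k = 1` case of DDS Thm. 3.2, PROVED** (with the explicit exponent `5` for the unnamed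
constant of `DDS2021_thm_3_2` at `k = 1`): a polynomial approximated by `Π^{[d]}Σ` circuits over
`F(ε)` within a budget `s ≥ 2` dominating `d` and `n` is computed exactly by an ABP with univariate
labels within budget `s ^ 5` — "The `k = 1` case is obvious, as `\overline{ΠΣ} = ΠΣ`
[`DDS2021_lemma_2_21_piSigma_holds`] and trivially it has a small ABP". This is the base of the
DiDIL induction only; `DDS2021_thm_3_2` itself (all `k`) is NOT proved here.
[cite: DuttaDwivediSaxena2022, Thm. 3.2 and its proof, `k = 1` case (full version p0026 L713–716)] -/
theorem uabpComputes_of_mem_border_spsClass_one (F : Type) [Field F] [CharZero F] (n d s : ℕ)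
    (f : MvPolynomial (Fin n) F) (hds : d ≤ s) (hns : n ≤ s) (hs : 2 ≤ s)
    (hf : f ∈ border (spsClass (RatFunc F) n 1 d)) : UABPComputes (s ^ 5) f := by
  have h1 : f ∈ spsClass F n 1 d := DDS2021_lemma_2_21_piSigma_holds F n d f hf
  refine (uabpComputes_of_mem_spsClass h1).mono ?_
  have h2 : d * ((n + 1) * 2 + 2) ≤ s * (s * 2 + 4) :=
    Nat.mul_le_mul hds (by omega)
  have h3 : s * (s * 2 + 4) + 4 ≤ s ^ 5 := by
    have hs2 : 4 ≤ s * s := by nlinarith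
    calc s * (s * 2 + 4) + 4 = 2 * (s * s) + 4 * s + 4 := by ring
      _ ≤ 2 * (s * s) + 2 * (s * s) + (s * s) := by nlinarith
      _ = 5 * (s * s) := by ring
      _ ≤ (s * s * s) * (s * s) := by
          have : 5 ≤ s * s * s := by nlinarith
          exact Nat.mul_le_mul_right _ this
      _ = s ^ 5 := by ring
  omega

end Layer4

/-! ## Layer 5: back to the tree's predicate `UABPComputes`

A nonzero polynomial computed by a program of length `L` forces `L + 1` vertices on distinct
layers, so `L < S`; hence the closure operations can be restated on `UABPComputes` itself with
budgets polynomial in the given budgets (lengths eliminated). -/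

section Layer5

variable {F : Type*} [CommSemiring F] {n : ℕ}

/-- Prefix reachability: a nonzero entry `(N ^ k) s v` yields, for every `j ≤ k`, a vertex `w`
with `(N ^ j) s w ≠ 0`. [folklore] -/
private theorem exists_pow_apply_ne_zero_of_le {ι : Type*} [Fintype ι] [DecidableEq ι]
    {R : Type*} [Semiring R] (N : Matrix ι ι R) (s : ι) :
    ∀ (k : ℕ) (v : ι), (N ^ k) s v ≠ 0 → ∀ j ≤ k, ∃ w, (N ^ j) s w ≠ 0 := by
  intro k
  induction k with
  | zero =>
    intro v hv j hj
    obtain rfl : j = 0 := Nat.le_zero.1 hj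
    exact ⟨v, hv⟩
  | succ k ih =>
    intro v hv j hj
    rw [pow_succ, Matrix.mul_apply] at hv
    obtain ⟨w, -, hw⟩ := Finset.exists_ne_zero_of_sum_ne_zero hv
    have hw' : (N ^ k) s w ≠ 0 := fun h0 => hw (by rw [h0, zero_mul])
    rcases Nat.lt_or_ge j (k + 1) with hlt | hge
    · exact ih w hw' j (by omega)
    · obtain rfl : j = k + 1 := le_antisymm hj hge
      refine ⟨v, ?_⟩
      rw [pow_succ, Matrix.mul_apply]
      exact hv

/-- **Length versus size**: a program computing a NONZERO polynomial with its sink `L` layers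
above its source has at least `L + 1` vertices (one on each layer in between), so `L < S`.
[cite: DuttaDwivediSaxena2022, Def. 2.5 (full version p0017 L468 – p0018 L476)] -/
theorem UABPComputesLen.length_lt {S L : ℕ} {f : MvPolynomial (Fin n) F}
    (hf : UABPComputesLen S L f) (h0 : f ≠ 0) : L < S := by
  obtain ⟨V, hV, layer, s, t, N, hlay, hlab, hst, hf⟩ := hf
  have hne : (N ^ L) s t ≠ 0 := by rwa [hf]
  have hreach := exists_pow_apply_ne_zero_of_le N s L t hne
  choose w hw using fun j : Fin (L + 1) => hreach j (by have := j.isLt; omega)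
  have hlayer : ∀ j : Fin (L + 1), layer (w j) = layer s + j := fun j => by
    by_contra hc
    exact hw j (pow_apply_eq_zero_of_layer hlay j s (w j) hc)
  have hinj : Function.Injective w := fun j₁ j₂ h => by
    have := hlayer j₁
    rw [h, hlayer j₂] at this
    exact Fin.ext (by omega)
  have := Fintype.card_le_of_injective w hinj
  simp only [Fintype.card_fin] at this
  omega

/-- Closure of `UABPComputes` under multiplication (budgets add).
[cite: DuttaDwivediSaxena2022, §2.1 remark after Def. 2.5 (full version p0018 L477–478)] -/
theorem UABPComputes.mul {S₁ S₂ : ℕ} {f g : MvPolynomial (Fin n) F} (hf : UABPComputes S₁ f)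
    (hg : UABPComputes S₂ g) : UABPComputes (S₁ + S₂) (f * g) := by
  obtain ⟨L₁, hf⟩ := hf.exists_len
  obtain ⟨L₂, hg⟩ := hg.exists_len
  exact (hf.mul hg).uabpComputes

/-- Closure of `UABPComputes` under addition, lengths eliminated by `length_lt`
(budget `4 (S₁ + S₂) + 2`). [cite: DuttaDwivediSaxena2022, §2.1 remark after Def. 2.5 (full version p0018 L477–478)] -/
theorem UABPComputes.add {S₁ S₂ : ℕ} {f g : MvPolynomial (Fin n) F} (hf : UABPComputes S₁ f)
    (hg : UABPComputes S₂ g) : UABPComputes (4 * (S₁ + S₂) + 2) (f + g) := by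
  by_cases hf0 : f = 0
  · rw [hf0, zero_add]
    exact hg.mono (by omega)
  by_cases hg0 : g = 0
  · rw [hg0, add_zero]
    exact hf.mono (by omega)
  obtain ⟨L₁, hf⟩ := hf.exists_len
  obtain ⟨L₂, hg⟩ := hg.exists_len
  have h1 := hf.length_lt hf0
  have h2 := hg.length_lt hg0
  exact ((hf.add' hg).mono (by omega)).uabpComputes

/-- Closure of `UABPComputes` under finite sums within a common budget `S ≥ 2`, lengths
eliminated by `length_lt` (budget `card ι · (2 S) + 2`).
[cite: DuttaDwivediSaxena2022, §2.1 remark after Def. 2.5 (full version p0018 L477–478)] -/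
theorem UABPComputes.sum {ι : Type*} [Fintype ι] [DecidableEq ι] {S : ℕ} (hS : 2 ≤ S)
    (f : ι → MvPolynomial (Fin n) F) (h : ∀ i, UABPComputes S (f i)) :
    UABPComputes (Fintype.card ι * (S + S) + 2) (∑ i, f i) := by
  classical
  have key : ∀ i, ∃ L, L ≤ S ∧ UABPComputesLen S L (f i) := fun i => by
    by_cases h0 : f i = 0
    · exact ⟨0, Nat.zero_le _, h0 ▸ UABPComputesLen.zero hS 0⟩
    · obtain ⟨L, hL⟩ := (h i).exists_len
      exact ⟨L, (hL.length_lt h0).le, hL⟩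
  choose L hLS hL using key
  exact (UABPComputesLen.sum_le f L hLS hL).uabpComputes

/-- Closure of `UABPComputes` under scaling by constants (budget `S + 2`).
[cite: DuttaDwivediSaxena2022, §2.1 remark after Def. 2.5 (full version p0018 L477–478)] -/
theorem UABPComputes.smul_C {S : ℕ} {f : MvPolynomial (Fin n) F} (hf : UABPComputes S f) (c : F) :
    UABPComputes (S + 2) (C c * f) := by
  obtain ⟨L, hf⟩ := hf.exists_len
  exact (hf.smul_C c).uabpComputes

/-- Closure of `UABPComputes` under affine univariate substitutions / partial evaluation (same
budget). [cite: DuttaDwivediSaxena2022, Lemma 2.6 proof (full version p0018 L486–498)] -/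
theorem UABPComputes.bind₁_affine {S : ℕ} {f : MvPolynomial (Fin n) F} (hf : UABPComputes S f)
    (φ : Fin n → MvPolynomial (Fin n) F) (hvars : ∀ j, (φ j).vars.card ≤ 1)
    (hdeg : ∀ j, (φ j).totalDegree ≤ 1) : UABPComputes S (bind₁ φ f) := by
  obtain ⟨L, hf⟩ := hf.exists_len
  exact (hf.bind₁_affine φ hvars hdeg).uabpComputes

/-- Homogeneous components on `UABPComputes` (budget `S · (D + 1)` for `k ≤ D`).
[cite: DuttaDwivediSaxena2022, Lemma 2.6 and its proof (full version p0018 L481–498)] -/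
theorem UABPComputes.homogeneousComponent {S : ℕ} {f : MvPolynomial (Fin n) F}
    (hf : UABPComputes S f) {D k : ℕ} (hk : k ≤ D) :
    UABPComputes (S * (D + 1)) (MvPolynomial.homogeneousComponent k f) := by
  obtain ⟨L, hf⟩ := hf.exists_len
  exact (hf.homogeneousComponent hk).uabpComputes

end Layer5

/-! ## Layer 6: the ABP-side calculus of DiDIL (DDS §3) — re-indexing and base change,
derivations ("derive"), truncation in one variable ("mod `z^D`"), and the map `Φ`

FRAME (read off the print). In DDS §3 the branching programs live over `F` in the variables
`x, z`: Claim 3.7 (p0034 L902–903: "`f_{k−1} = ∂_z(f_{k−2}/t_{2,k−2})` has a ABP/ABP circuit over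
`F(x, z)`, i.e. each denominator and numerator is being computed in `F[x, z]`") and the end of
the proof (p0036 L959–961: "obtain an `ε`-free ABP over `F[x, z]` computing `Φ(f)`. Apply the map
`Φ^{-1}` to obtain the final ABP … computing the polynomial `f`"). So on the ABP side `z` is one
more VARIABLE (index `0` of `Fin (n + 1)`, the `x_i` becoming `Fin.succ i`), the reductions
"mod `z^{d_j}`" of the rings `R_j = F[z]/⟨z^{d_j}⟩` (p0028 L755, p0031 L815, p0035 L926 "multiply …
and truncate it till `d_{k−2} − 1`") are truncations in the `z`-degree, "Derive" (p0028 L764 –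
p0029 L766, Eqns. (3.1)/(3.2)) is the partial derivative `∂_z`, and `ε` never enters an ABP (the
limits `ε → 0` are taken on the `ΠΣ` / `Σ∧Σ` side first: Lemma 2.21 / 2.23, Claims 3.3 / 3.8).
This layer provides exactly these operations, with explicit budgets:

* `bind₁_affine'` (affine univariate substitutions into ANOTHER set of variables; same `S, L`),
  `rename` (re-indexing of variables; same `S, L`), `map` (change of coefficients along a ring
  homomorphism; same `S, L`);
* `derivation` / `pderiv`: ABPs are closed under derivations that keep labels univariate without
  raising degrees — the TWO-COPY construction (`2 S` vertices, SAME length);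
* `weightedHomogeneousComponent` / `truncateWeighted`: the graded copy for an arbitrary weight
  `w : Fin n → ℕ` (`S · (D+1)` vertices, same length / `(D+1) · S · (D+1) + 2`, `L + 2`); for the
  weight `Pi.single i 1` this is the truncation "mod `x_i^{D+1}`" (`coeff_truncateDegreeOf`,
  `truncateDegreeOf_eq_self`);
* `aeval_phi`: the DiDIL map `Φ : x_i ↦ z · x_i + α_i` (p0028 L751–753) with `z` a variable, via
  the homogeneous decomposition of the shifted polynomial (`Φ(f) = ∑_k z^k · (f(x + α))_k`), and
  `of_aeval_phi`: "apply `Φ^{-1}`" (`z := 1`, then `x ↦ x − α`; same `S, L`). -/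

section Layer6

variable {F : Type*} [CommSemiring F] {n : ℕ}

/-! ### Re-indexing and base change -/

/-- **Affine univariate substitutions into another set of variables** `x_j ↦ φ j ∈ F[y_1..y_{n'}]`
(each `φ j` with at most one variable and of degree `≤ 1`): label by label, same vertices, layers
and length (the heterogeneous form of `bind₁_affine`; used to move programs between `F[x]` and
`F[x, z]`). [cite: DuttaDwivediSaxena2022, Lemma 2.6 proof (full version p0018 L486–498)] -/
theorem UABPComputesLen.bind₁_affine' {n' S L : ℕ} {f : MvPolynomial (Fin n) F}
    (hf : UABPComputesLen S L f) (φ : Fin n → MvPolynomial (Fin n') F)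
    (hvars : ∀ j, (φ j).vars.card ≤ 1) (hdeg : ∀ j, (φ j).totalDegree ≤ 1) :
    UABPComputesLen S L (bind₁ φ f) := by
  obtain ⟨V, hV, layer, s, t, N, hlay, hlab, hst, hf⟩ := hf
  refine ⟨V, hV, layer, s, t, N.map (bind₁ φ), ?_, ?_, hst, ?_⟩
  · intro u v h
    exact hlay u v fun h0 => h (by rw [Matrix.map_apply, h0, map_zero])
  · intro u v
    exact ⟨card_vars_bind₁_le_one φ hvars _ (hlab u v).1,
      (totalDegree_bind₁_le_of_le_one φ hdeg _).trans (hlab u v).2⟩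
  · have hpow : (N.map (bind₁ φ)) ^ L = (N ^ L).map (bind₁ φ) := by
      have h := ((bind₁ φ).toRingHom.mapMatrix (m := Fin V)).map_pow N L
      simpa [RingHom.mapMatrix_apply] using h.symm
    rw [hpow, Matrix.map_apply, hf]

/-- `bind₁ (X ∘ g)` is `rename g`. [folklore] -/
private theorem bind₁_X_comp_eq_rename {σ τ : Type*} (g : σ → τ) (f : MvPolynomial σ F) :
    bind₁ (fun j => X (g j)) f = rename g f := by
  induction f using MvPolynomial.induction_on with
  | C a => simp
  | add p q hp hq => simp [hp, hq]
  | mul_X p i hp => simp [hp]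

/-- **Re-indexing of variables** along any `g : Fin n → Fin n'` (`rename g`): same budget, same
length (labels `p(x_m)` become `p(x_{g m})`). This is how a program for `f ∈ F[x]` is read in
`F[x, z]` (`g = Fin.succ`, the new variable `z = x_0`).
[cite: DuttaDwivediSaxena2022, Def. 2.5 (full version p0017 L468 – p0018 L476)] -/
theorem UABPComputesLen.rename {n' S L : ℕ} {f : MvPolynomial (Fin n) F}
    (hf : UABPComputesLen S L f) (g : Fin n → Fin n') : UABPComputesLen S L (rename g f) := by
  have h := hf.bind₁_affine' (fun j => X (g j)) (fun j => card_vars_X_le_one _)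
    (fun j => totalDegree_X_le_one _)
  rwa [bind₁_X_comp_eq_rename] at h

/-- Changing coefficients along a ring homomorphism does not raise the total degree.
[folklore] -/
private theorem totalDegree_map_le_self {F' : Type*} [CommSemiring F'] {σ : Type*} (φ : F →+* F')
    (p : MvPolynomial σ F) : (MvPolynomial.map φ p).totalDegree ≤ p.totalDegree := by
  rw [totalDegree, totalDegree]
  exact Finset.sup_mono (support_map_subset φ p)

/-- **Change of coefficients** along a ring homomorphism `φ : F →+* F'` (`MvPolynomial.map φ`,
label by label): same budget, same length.
[cite: DuttaDwivediSaxena2022, Def. 2.5 (full version p0017 L468 – p0018 L476)] -/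
theorem UABPComputesLen.map {F' : Type*} [CommSemiring F'] {S L : ℕ} {f : MvPolynomial (Fin n) F}
    (hf : UABPComputesLen S L f) (φ : F →+* F') :
    UABPComputesLen S L (MvPolynomial.map φ f) := by
  classical
  obtain ⟨V, hV, layer, s, t, N, hlay, hlab, hst, hf⟩ := hf
  refine ⟨V, hV, layer, s, t, N.map (MvPolynomial.map φ), ?_, ?_, hst, ?_⟩
  · intro u v h
    exact hlay u v fun h0 => h (by rw [Matrix.map_apply, h0, map_zero])
  · intro u v
    exact ⟨(Finset.card_le_card (vars_map (N u v) φ)).trans (hlab u v).1,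
      (totalDegree_map_le_self φ _).trans (hlab u v).2⟩
  · have hpow : (N.map (MvPolynomial.map φ)) ^ L = (N ^ L).map (MvPolynomial.map φ) := by
      have h := ((MvPolynomial.map φ).mapMatrix (m := Fin V)).map_pow N L
      simpa [RingHom.mapMatrix_apply] using h.symm
    rw [hpow, Matrix.map_apply, hf]

/-! ### Derivations: "Derive" by the two-copy construction -/

/-- Entrywise derivations obey the Leibniz rule for matrix powers:
`D(N^k) = ∑_{i<k} N^i · D(N) · N^{k−1−i}`. [folklore] -/
private theorem matrix_map_pow_derivation {ι : Type*} [Fintype ι] [DecidableEq ι] {R A : Type*}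
    [CommSemiring R] [CommSemiring A] [Algebra R A] (D : Derivation R A A) (N : Matrix ι ι A)
    (k : ℕ) :
    (N ^ k).map D = ∑ i ∈ Finset.range k, N ^ i * N.map D * N ^ (k - 1 - i) := by
  induction k with
  | zero =>
    rw [Finset.sum_range_zero, pow_zero]
    refine Matrix.ext fun u v => ?_
    rw [Matrix.map_apply, Matrix.one_apply, Matrix.zero_apply]
    split_ifs
    · exact D.map_one_eq_zero
    · exact map_zero D
  | succ k ih =>
    have step : (N ^ (k + 1)).map D = N ^ k * N.map D + (N ^ k).map D * N := by
      refine Matrix.ext fun u v => ?_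
      rw [pow_succ, Matrix.map_apply, Matrix.mul_apply, map_sum, Matrix.add_apply,
        Matrix.mul_apply, Matrix.mul_apply, ← Finset.sum_add_distrib]
      refine Finset.sum_congr rfl fun w _ => ?_
      rw [Derivation.leibniz, Matrix.map_apply, Matrix.map_apply, smul_eq_mul, smul_eq_mul,
        mul_comm (N w v)]
    rw [step, ih, Finset.sum_range_succ, show k + 1 - 1 - k = 0 from by omega, pow_zero,
      Matrix.mul_one, add_comm, Finset.sum_mul]
    congr 1
    refine Finset.sum_congr rfl fun i hi => ?_
    rw [Finset.mem_range] at hi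
    rw [show k + 1 - 1 - i = k - 1 - i + 1 from by omega, pow_succ]
    simp only [Matrix.mul_assoc]

/-- **ABPs are closed under derivations** (the TWO-COPY construction): for a derivation `D` of
`F[x]` that keeps univariate labels univariate without raising their degree (e.g. `∂_{x_i}`), if
`f` has a program on `≤ S` vertices of length `L` then `D f` has one on `≤ 2 S` vertices of the
SAME length — two copies of the program, with an edge from `u` in the first copy to `v` in the
second labelled `D(N u v)` (a path crosses over exactly once, differentiating exactly one label:
the Leibniz rule `D(N^L) = ∑_i N^i · D(N) · N^{L−1−i}`). This is the ABP side of "Derive" in DiDIL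
(Eqns. (3.1)/(3.2)). [cite: DuttaDwivediSaxena2022, §3 proof of Thm. 3.2, "Divide and Derive" (full version p0028 L764 – p0029 L766; p0030 L808 – p0031 L812)] -/
theorem UABPComputesLen.derivation {R : Type*} [CommSemiring R] [Algebra R (MvPolynomial (Fin n) F)]
    (D : Derivation R (MvPolynomial (Fin n) F) (MvPolynomial (Fin n) F)) {S L : ℕ}
    (hD : ∀ p : MvPolynomial (Fin n) F, p.vars.card ≤ 1 → p.totalDegree ≤ S →
      (D p).vars.card ≤ 1 ∧ (D p).totalDegree ≤ S)
    {f : MvPolynomial (Fin n) F} (hf : UABPComputesLen S L f) :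
    UABPComputesLen (2 * S) L (D f) := by
  obtain ⟨V, hV, layer, s, t, N, hlay, hlab, hst, hf⟩ := hf
  refine UABPComputesLen.of_fintype (ι := Fin V ⊕ Fin V) (by simp; omega)
    (Sum.elim layer layer) (Sum.inl s) (Sum.inr t) (Matrix.fromBlocks N (N.map D) 0 N)
    ?_ ?_ ?_ ?_
  · rintro (u | u) (v | v) h
    · simp only [Matrix.fromBlocks_apply₁₁] at h
      simp [hlay u v h]
    · simp only [Matrix.fromBlocks_apply₁₂, Matrix.map_apply] at h
      have h' : N u v ≠ 0 := fun h0 => h (by rw [h0, map_zero])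
      simp [hlay u v h']
    · simp at h
    · simp only [Matrix.fromBlocks_apply₂₂] at h
      simp [hlay u v h]
  · rintro (u | u) (v | v)
    · exact ⟨(hlab u v).1, (hlab u v).2.trans (by omega)⟩
    · simp only [Matrix.fromBlocks_apply₁₂, Matrix.map_apply]
      have h := hD _ (hlab u v).1 (hlab u v).2
      exact ⟨h.1, h.2.trans (by omega)⟩
    · simp
    · exact ⟨(hlab u v).1, (hlab u v).2.trans (by omega)⟩
  · simp [hst]
  · rw [fromBlocks_zero₂₁_pow_eq, Matrix.fromBlocks_apply₁₂, ← matrix_map_pow_derivation,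
      Matrix.map_apply, hf]

/-- A partial derivative involves no new variables. [folklore] -/
private theorem vars_pderiv_subset {σ : Type*} [DecidableEq σ] (i : σ) (p : MvPolynomial σ F) :
    (MvPolynomial.pderiv i p).vars ⊆ p.vars := by
  intro j hj
  rw [mem_vars_iff_mem_support] at hj ⊢
  obtain ⟨d, hd, hjd⟩ := hj
  refine ⟨d + Finsupp.single i 1, ?_, ?_⟩
  · rw [mem_support_iff] at hd ⊢
    rw [coeff_pderiv] at hd
    exact fun h0 => hd (by rw [h0, zero_mul])
  · rw [Finsupp.mem_support_iff] at hjd ⊢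
    rw [Finsupp.add_apply]
    omega

/-- A partial derivative does not raise the total degree. [folklore] -/
private theorem totalDegree_pderiv_le {σ : Type*} (i : σ) (p : MvPolynomial σ F) :
    (MvPolynomial.pderiv i p).totalDegree ≤ p.totalDegree := by
  classical
  refine Finset.sup_le fun d hd => ?_
  rw [mem_support_iff, coeff_pderiv] at hd
  have hd' : d + Finsupp.single i 1 ∈ p.support := by
    rw [mem_support_iff]
    exact fun h0 => hd (by rw [h0, zero_mul])
  refine le_trans ?_ (le_totalDegree hd')
  rw [Finsupp.sum_add_index' (fun _ => rfl) (fun _ _ _ => rfl)]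
  exact Nat.le_add_right _ _

/-- **ABPs are closed under partial derivatives** `∂_{x_i}` (`2 S` vertices, same length) — in
particular under `∂_z` for the variable `z = x_0` of DiDIL ("Derive", Eqns. (3.1)/(3.2)).
[cite: DuttaDwivediSaxena2022, §3 proof of Thm. 3.2, "Divide and Derive" (full version p0028 L764 – p0029 L766; p0030 L808 – p0031 L812)] -/
theorem UABPComputesLen.pderiv {S L : ℕ} {f : MvPolynomial (Fin n) F} (hf : UABPComputesLen S L f)
    (i : Fin n) : UABPComputesLen (2 * S) L (MvPolynomial.pderiv i f) :=
  hf.derivation (MvPolynomial.pderiv i) fun p hv hd =>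
    ⟨(Finset.card_le_card (vars_pderiv_subset i p)).trans hv, (totalDegree_pderiv_le i p).trans hd⟩

/-! ### Truncation in one variable ("mod `z^D`"): the weighted-degree graded copy -/

/-- Weighted homogeneous components of a product (Cauchy product formula), for a weight
`w : σ → ℕ`: `(p q)_k = ∑_{i ≤ k} p_i q_{k−i}`. [folklore] -/
private theorem weightedHomogeneousComponent_mul_eq_sum {σ : Type*} (w : σ → ℕ) (k : ℕ)
    (p q : MvPolynomial σ F) :
    weightedHomogeneousComponent w k (p * q) =
      ∑ i ∈ Finset.range (k + 1),
        weightedHomogeneousComponent w i p * weightedHomogeneousComponent w (k - i) q := by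
  classical
  ext d
  rw [coeff_weightedHomogeneousComponent, coeff_sum]
  simp_rw [coeff_mul, coeff_weightedHomogeneousComponent]
  rw [Finset.sum_comm]
  split_ifs with hd
  · refine Finset.sum_congr rfl fun x hx => ?_
    have hx' : x.1 + x.2 = d := by simpa using hx
    have hdeg : Finsupp.weight w x.1 + Finsupp.weight w x.2 = k := by rw [← map_add, hx', hd]
    rw [Finset.sum_eq_single_of_mem (Finsupp.weight w x.1) (Finset.mem_range.2 (by omega))]
    · rw [if_pos rfl, if_pos (by omega)]
    · intro i _ hi
      rw [if_neg (Ne.symm hi), zero_mul]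
  · refine (Finset.sum_eq_zero fun x hx => Finset.sum_eq_zero fun i hi => ?_).symm
    have hx' : x.1 + x.2 = d := by simpa using hx
    have hi' := Finset.mem_range.1 hi
    by_cases h1 : Finsupp.weight w x.1 = i
    · by_cases h2 : Finsupp.weight w x.2 = k - i
      · exfalso
        apply hd
        rw [← hx', map_add, h1, h2]
        omega
      · rw [if_neg h2, mul_zero]
    · rw [if_neg h1, zero_mul]

/-- A weighted homogeneous component involves no new variables. [folklore] -/
private theorem card_vars_weightedHomogeneousComponent_le {σ : Type*} (w : σ → ℕ) (e : ℕ)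
    (p : MvPolynomial σ F) (hp : p.vars.card ≤ 1) :
    (weightedHomogeneousComponent w e p).vars.card ≤ 1 := by
  classical
  refine (Finset.card_le_card fun i hi => ?_).trans hp
  rw [mem_vars_iff_mem_support] at hi ⊢
  obtain ⟨d, hd, hid⟩ := hi
  refine ⟨d, ?_, hid⟩
  rw [mem_support_iff, coeff_weightedHomogeneousComponent] at hd
  rw [mem_support_iff]
  intro h0
  exact hd (by simp [h0])

/-- A weighted homogeneous component does not raise the total degree. [folklore] -/
private theorem totalDegree_weightedHomogeneousComponent_le {σ : Type*} (w : σ → ℕ) (e : ℕ)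
    (p : MvPolynomial σ F) : (weightedHomogeneousComponent w e p).totalDegree ≤ p.totalDegree := by
  classical
  rw [totalDegree, totalDegree]
  refine Finset.sup_mono fun d hd => ?_
  rw [mem_support_iff, coeff_weightedHomogeneousComponent] at hd
  rw [mem_support_iff]
  intro h0
  exact hd (by simp [h0])

/-- The truncated weighted Toeplitz matrix of a polynomial: `(a, b) ↦ [a ≤ b] · p^{(w)}_{b−a}` on
`Fin (D+1) × Fin (D+1)`. [folklore] -/
private noncomputable def wToeplitz (w : Fin n → ℕ) (D : ℕ) (p : MvPolynomial (Fin n) F) :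
    Matrix (Fin (D + 1)) (Fin (D + 1)) (MvPolynomial (Fin n) F) :=
  Matrix.of fun a b => if (a : ℕ) ≤ b then weightedHomogeneousComponent w ((b : ℕ) - a) p else 0

/-- Entries of `wToeplitz`. [folklore] -/
private theorem wToeplitz_apply (w : Fin n → ℕ) (D : ℕ) (p : MvPolynomial (Fin n) F)
    (a b : Fin (D + 1)) :
    wToeplitz w D p a b =
      if (a : ℕ) ≤ b then weightedHomogeneousComponent w ((b : ℕ) - a) p else 0 := rfl

/-- `wToeplitz w D 1 = 1`. [folklore] -/
private theorem wToeplitz_one (w : Fin n → ℕ) (D : ℕ) :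
    wToeplitz w D (1 : MvPolynomial (Fin n) F) = 1 := by
  refine Matrix.ext fun a b => ?_
  rw [wToeplitz_apply, Matrix.one_apply]
  have h1 : ∀ m : ℕ, weightedHomogeneousComponent w m (1 : MvPolynomial (Fin n) F) =
      if m = 0 then 1 else 0 := fun m => by
    rw [← C_1, weightedHomogeneousComponent_of_mem ((mem_weightedHomogeneousSubmodule _ _ _ _).2
      (isWeightedHomogeneous_C _ _))]
  by_cases hab : a = b
  · subst hab
    simp [h1]
  · have hne : (a : ℕ) ≠ b := fun h => hab (Fin.ext h)
    rw [if_neg hab]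
    split_ifs with hle
    · rw [h1, if_neg (by omega)]
    · rfl

/-- `wToeplitz w D (p * q) = wToeplitz w D p * wToeplitz w D q` (the Cauchy product, truncated).
[folklore] -/
private theorem wToeplitz_mul (w : Fin n → ℕ) (D : ℕ) (p q : MvPolynomial (Fin n) F) :
    wToeplitz w D (p * q) = wToeplitz w D p * wToeplitz w D q := by
  refine Matrix.ext fun a b => ?_
  rw [Matrix.mul_apply, wToeplitz_apply]
  simp only [wToeplitz_apply]
  by_cases hab : (a : ℕ) ≤ b
  · rw [if_pos hab, weightedHomogeneousComponent_mul_eq_sum]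
    rw [Fin.sum_univ_eq_sum_range (fun c : ℕ =>
      (if (a : ℕ) ≤ c then weightedHomogeneousComponent w (c - a) p else 0) *
        (if c ≤ (b : ℕ) then weightedHomogeneousComponent w ((b : ℕ) - c) q else 0)) (D + 1)]
    have key : ∀ c ∈ Finset.range (D + 1),
        (if (a : ℕ) ≤ c then weightedHomogeneousComponent w (c - a) p else 0) *
          (if c ≤ (b : ℕ) then weightedHomogeneousComponent w ((b : ℕ) - c) q else 0) =
        if c ∈ Finset.Ico (a : ℕ) (b + 1) then
          weightedHomogeneousComponent w (c - a) p *
            weightedHomogeneousComponent w ((b : ℕ) - c) q else 0 := by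
      intro c _
      by_cases h1 : (a : ℕ) ≤ c
      · by_cases h2 : c ≤ (b : ℕ)
        · rw [if_pos h1, if_pos h2, if_pos (Finset.mem_Ico.2 ⟨h1, by omega⟩)]
        · rw [if_pos h1, if_neg h2, mul_zero,
            if_neg fun h => h2 (by have := (Finset.mem_Ico.1 h).2; omega)]
      · rw [if_neg h1, zero_mul, if_neg fun h => h1 (Finset.mem_Ico.1 h).1]
    rw [Finset.sum_congr rfl key, Finset.sum_ite_mem]
    have hfilter : Finset.range (D + 1) ∩ Finset.Ico (a : ℕ) (b + 1) =
        Finset.Ico (a : ℕ) (b + 1) := by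
      ext c
      simp only [Finset.mem_inter, Finset.mem_range, Finset.mem_Ico]
      have := b.isLt
      omega
    rw [hfilter, Finset.sum_Ico_eq_sum_range,
      show (b : ℕ) + 1 - a = (b : ℕ) - a + 1 from by omega]
    refine Finset.sum_congr rfl fun i hi => ?_
    rw [Finset.mem_range] at hi
    rw [show (a : ℕ) + i - a = i from by omega,
      show (b : ℕ) - (a + i) = (b : ℕ) - a - i from by omega]
  · rw [if_neg hab]
    symm
    refine Finset.sum_eq_zero fun c _ => ?_
    by_cases h1 : (a : ℕ) ≤ c
    · rw [if_neg (show ¬ ((c : ℕ) ≤ b) from by omega), mul_zero]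
    · rw [if_neg h1, zero_mul]

/-- `p ↦ wToeplitz w D p` as a ring homomorphism. [folklore] -/
private noncomputable def wToeplitzRingHom (w : Fin n → ℕ) (D : ℕ) :
    MvPolynomial (Fin n) F →+* Matrix (Fin (D + 1)) (Fin (D + 1)) (MvPolynomial (Fin n) F) where
  toFun := wToeplitz w D
  map_one' := wToeplitz_one w D
  map_mul' := wToeplitz_mul w D
  map_zero' := by
    refine Matrix.ext fun a b => ?_
    simp [wToeplitz_apply]
  map_add' p q := by
    refine Matrix.ext fun a b => ?_
    simp only [wToeplitz_apply, Matrix.add_apply]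
    split_ifs <;> simp

/-- **Weighted homogeneous components of an ABP-computed polynomial** (the graded copy for the
weight `w : Fin n → ℕ`: `(D+1)`-fold vertex blow-up, same length): for `k ≤ D`, the component
of `w`-weight `k` of `f` is computed within budget `S · (D + 1)`. For `w = Pi.single i 1` the
weight of a monomial is its `x_i`-degree, so this is the bookkeeping of the `z`-adic truncations
"mod `z^{d_j}`" of DiDIL (`R_j = F[z]/⟨z^{d_j}⟩`, p0028 L755, p0031 L815) on the ABP side.
[cite: DuttaDwivediSaxena2022, §3 proof of Thm. 3.2, Claims 3.4–3.7 (full version p0028 L755, p0031 L815, p0035 L926)] -/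
theorem UABPComputesLen.weightedHomogeneousComponent (w : Fin n → ℕ) {S L : ℕ}
    {f : MvPolynomial (Fin n) F} (hf : UABPComputesLen S L f) {D k : ℕ} (hk : k ≤ D) :
    UABPComputesLen (S * (D + 1)) L (weightedHomogeneousComponent w k f) := by
  obtain ⟨V, hV, layer, s, t, N, hlay, hlab, hst, hf⟩ := hf
  refine UABPComputesLen.of_fintype (ι := Fin V × Fin (D + 1))
    (by simpa using Nat.mul_le_mul_right (D + 1) hV)
    (fun x => layer x.1) (s, 0) (t, ⟨k, by omega⟩)
    (Matrix.comp _ _ _ _ _ ((wToeplitzRingHom w D).mapMatrix N)) ?_ ?_ hst ?_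
  · rintro ⟨u, a⟩ ⟨v, b⟩ h
    refine hlay u v fun h0 => h ?_
    simp [RingHom.mapMatrix_apply, wToeplitzRingHom, wToeplitz_apply, h0]
  · rintro ⟨u, a⟩ ⟨v, b⟩
    simp only [Matrix.comp_apply, RingHom.mapMatrix_apply, Matrix.map_apply]
    show ((wToeplitz w D (N u v)) a b).vars.card ≤ 1 ∧
      ((wToeplitz w D (N u v)) a b).totalDegree ≤ _
    rw [wToeplitz_apply]
    split_ifs
    · exact ⟨card_vars_weightedHomogeneousComponent_le _ _ _ (hlab u v).1,
        (totalDegree_weightedHomogeneousComponent_le _ _ _).trans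
          ((hlab u v).2.trans (Nat.le_mul_of_pos_right S (Nat.succ_pos D)))⟩
    · simp
  · rw [← Matrix.compRingEquiv_apply, ← map_pow, ← map_pow, Matrix.compRingEquiv_apply,
      Matrix.comp_apply, RingHom.mapMatrix_apply, Matrix.map_apply, hf]
    show wToeplitz w D f 0 ⟨k, _⟩ = _
    rw [wToeplitz_apply]
    simp

/-- **Weighted truncation** `∑_{k ≤ D} f^{(w)}_k` of an ABP-computed polynomial (parallel
composition of the `D + 1` graded copies; budget `(D+1) · S · (D+1) + 2`, length `L + 2`).
[cite: DuttaDwivediSaxena2022, §3 proof of Thm. 3.2, Claims 3.4–3.7 (full version p0028 L755, p0031 L815, p0035 L926)] -/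
theorem UABPComputesLen.truncateWeighted (w : Fin n → ℕ) {S L : ℕ} {f : MvPolynomial (Fin n) F}
    (hf : UABPComputesLen S L f) (D : ℕ) :
    UABPComputesLen ((D + 1) * (S * (D + 1)) + 2) (L + 2)
      (∑ k ∈ Finset.range (D + 1), MvPolynomial.weightedHomogeneousComponent w k f) := by
  classical
  rw [Finset.sum_range]
  have h := UABPComputesLen.sum (ι := Fin (D + 1))
    (fun k => MvPolynomial.weightedHomogeneousComponent w (k : ℕ) f)
    fun k => hf.weightedHomogeneousComponent w (D := D) (k := k) (by have := k.isLt; omega)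
  simpa [Fintype.card_fin] using h

/-- **Truncation in one variable, coefficientwise**: with the weight `Pi.single i 1` the weighted
truncation keeps exactly the monomials of `x_i`-degree `≤ D` ("mod `x_i^{D+1}`"; for `x_i = z`
this is reduction to `R = F[z]/⟨z^{D+1}⟩` read on canonical representatives).
[cite: DuttaDwivediSaxena2022, §3 proof of Thm. 3.2 (full version p0028 L755 "`R_0 := F[z]/⟨z^d⟩`")] -/
theorem coeff_truncateDegreeOf (i : Fin n) (D : ℕ) (f : MvPolynomial (Fin n) F) (d : Fin n →₀ ℕ) :
    coeff d (∑ k ∈ Finset.range (D + 1), weightedHomogeneousComponent (Pi.single i 1) k f) =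
      if d i ≤ D then coeff d f else 0 := by
  classical
  rw [coeff_sum]
  simp_rw [coeff_weightedHomogeneousComponent, Finsupp.weight_single_one_apply]
  rw [Finset.sum_ite_eq]
  by_cases h : d i ≤ D
  · rw [if_pos (Finset.mem_range.2 (Nat.lt_succ_of_le h)), if_pos h]
  · rw [if_neg (fun hm => h (Nat.le_of_lt_succ (Finset.mem_range.1 hm))), if_neg h]

/-- If the `x_i`-degree of `f` is at most `D`, truncation "mod `x_i^{D+1}`" does nothing.
[cite: DuttaDwivediSaxena2022, §3 proof of Thm. 3.2 (full version p0028 L756–757 "prove the size upper bound for `Φ(f_0)` which is free of mod `z^d`")] -/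
theorem truncateDegreeOf_eq_self (i : Fin n) {D : ℕ} {f : MvPolynomial (Fin n) F}
    (hD : f.degreeOf i ≤ D) :
    (∑ k ∈ Finset.range (D + 1), weightedHomogeneousComponent (Pi.single i 1) k f) = f := by
  classical
  ext d
  rw [coeff_truncateDegreeOf]
  split_ifs with h
  · rfl
  · by_contra hne
    have hd : d ∈ f.support := by
      rw [mem_support_iff]
      exact fun h0 => hne (h0 ▸ rfl)
    exact h ((monomial_le_degreeOf i hd).trans hD)

/-! ### The DiDIL map `Φ : x_i ↦ z · x_i + α_i` (with `z` a variable) and its inverse -/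

/-- On a homogeneous polynomial of degree `k`, the dilation `x_i ↦ x_0 · x_{i+1}` acts as
`x_0^k · (rename Fin.succ)`. [folklore] -/
private theorem bind₁_X_zero_mul_X_succ_of_isHomogeneous {k : ℕ} {g : MvPolynomial (Fin n) F}
    (hg : g.IsHomogeneous k) :
    bind₁ (fun i : Fin n => (X 0 * X i.succ : MvPolynomial (Fin (n + 1)) F)) g =
      X 0 ^ k * rename Fin.succ g := by
  classical
  conv_lhs => rw [g.as_sum]
  conv_rhs => rw [g.as_sum]
  rw [map_sum, map_sum, Finset.mul_sum]
  refine Finset.sum_congr rfl fun d hd => ?_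
  have hdeg : ∑ i ∈ d.support, d i = k := by
    have h := hg (mem_support_iff.1 hd)
    simpa [Finsupp.weight_apply, Finsupp.sum] using h
  rw [bind₁_monomial, rename_monomial, monomial_eq, Finsupp.prod_mapDomain_index_inj
    (Fin.succ_injective n)]
  simp only [mul_pow, Finset.prod_mul_distrib, Finset.prod_pow_eq_pow_sum, hdeg, Finsupp.prod]
  ring

/-- The part of degree `≤ D` of a polynomial of total degree `≤ D` is the polynomial.
[folklore] -/
private theorem sum_homogeneousComponent_range_of_le {D : ℕ} (g : MvPolynomial (Fin n) F)
    (hg : g.totalDegree ≤ D) :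
    (∑ k ∈ Finset.range (D + 1), homogeneousComponent k g) = g := by
  conv_rhs => rw [← sum_homogeneousComponent g]
  symm
  refine Finset.sum_subset (fun k hk => ?_) fun k _ hk => ?_
  · rw [Finset.mem_range] at hk ⊢
    omega
  · rw [Finset.mem_range, not_lt] at hk
    exact homogeneousComponent_eq_zero _ _ (by omega)

/-- **The DiDIL map `Φ`** ("`Φ : F(ε)[x] → F(ε)[x, z]`, such that `x_i ↦ z · x_i + α_i`",
p0028 L751–753), on the ABP side and with `z` the new VARIABLE `x_0` (the `x_i` re-indexed as
`x_{i+1}`): if `f` (of total degree `≤ D`) has a program on `≤ S` vertices of length `L`, then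
`Φ(f)` has one within budget `(D+1) · (D + 2 + S · (D+1)) + 2` of length `L + 4`. Construction:
`Φ(f) = ∑_{k ≤ D} z^k · (f(x + α))_k` — shift (`bind₁_affine`), degree-graded copies
(`homogeneousComponent`), re-indexing (`rename`), one edge `z^k`, parallel composition.
[cite: DuttaDwivediSaxena2022, §3 proof of Thm. 3.2, "Φ homomorphism" (full version p0028 L751–757)] -/
theorem UABPComputesLen.aeval_phi {S L D : ℕ} {f : MvPolynomial (Fin n) F}
    (hf : UABPComputesLen S L f) (hD : f.totalDegree ≤ D) (α : Fin n → F) :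
    UABPComputesLen ((D + 1) * (D + 2 + S * (D + 1)) + 2) (L + 4)
      (aeval (fun i : Fin n => (X 0 * X i.succ + C (α i) : MvPolynomial (Fin (n + 1)) F)) f) := by
  classical
  set g : MvPolynomial (Fin n) F := bind₁ (fun i : Fin n => X i + C (α i)) f with hg_def
  have hθvars : ∀ i : Fin n, (X i + C (α i) : MvPolynomial (Fin n) F).vars.card ≤ 1 := fun i => by
    refine (Finset.card_le_card (vars_add_subset _ _)).trans ?_
    rw [vars_C, Finset.union_empty]
    exact card_vars_X_le_one (F := F) i
  have hθdeg : ∀ i : Fin n, (X i + C (α i) : MvPolynomial (Fin n) F).totalDegree ≤ 1 := fun i =>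
    (totalDegree_add _ _).trans (max_le (totalDegree_X_le_one (F := F) i) (by simp))
  have hg : UABPComputesLen S L g := hf.bind₁_affine _ hθvars hθdeg
  have hgD : g.totalDegree ≤ D := (totalDegree_bind₁_le_of_le_one _ hθdeg f).trans hD
  -- the identity `Φ(f) = ∑_{k ≤ D} z^k · rename succ (g_k)`
  have key : aeval (fun i : Fin n => (X 0 * X i.succ + C (α i) : MvPolynomial (Fin (n + 1)) F)) f =
      ∑ k : Fin (D + 1), X 0 ^ (k : ℕ) *
        MvPolynomial.rename Fin.succ (MvPolynomial.homogeneousComponent (k : ℕ) g) := by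
    have h1 : aeval (fun i : Fin n => (X 0 * X i.succ + C (α i) : MvPolynomial (Fin (n + 1)) F)) f =
        bind₁ (fun i : Fin n => (X 0 * X i.succ : MvPolynomial (Fin (n + 1)) F)) g := by
      have hfun : (fun i : Fin n => (X 0 * X i.succ + C (α i) : MvPolynomial (Fin (n + 1)) F)) =
          fun i => bind₁ (fun j : Fin n => (X 0 * X j.succ : MvPolynomial (Fin (n + 1)) F))
            (X i + C (α i)) := by
        funext i
        simp
      rw [aeval_eq_bind₁, hg_def, bind₁_bind₁, hfun]
    rw [h1, ← Finset.sum_range (fun k => X 0 ^ k *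
      MvPolynomial.rename Fin.succ (MvPolynomial.homogeneousComponent k g))]
    conv_lhs => rw [← sum_homogeneousComponent_range_of_le g hgD]
    rw [map_sum]
    refine Finset.sum_congr rfl fun k _ => ?_
    exact bind₁_X_zero_mul_X_succ_of_isHomogeneous (homogeneousComponent_isHomogeneous k g)
  rw [key]
  have hterm : ∀ k : Fin (D + 1), UABPComputesLen (D + 2 + S * (D + 1)) (1 + L + 1)
      (X 0 ^ (k : ℕ) * MvPolynomial.rename Fin.succ
        (MvPolynomial.homogeneousComponent (k : ℕ) g) : MvPolynomial (Fin (n + 1)) F) :=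
      fun k => by
    have hk : (k : ℕ) ≤ D := by have := k.isLt; omega
    refine (UABPComputesLen.of_label (S := D + 2) (by omega) _ ?_ ?_).mul
      ((hg.homogeneousComponent hk).rename Fin.succ)
    · exact (Finset.card_le_card (vars_pow _ _)).trans (card_vars_X_le_one (F := F) _)
    · refine (totalDegree_pow _ _).trans ?_
      have := totalDegree_X_le_one (F := F) (σ := Fin (n + 1)) 0
      nlinarith
  have h := UABPComputesLen.sum _ hterm
  rw [Fintype.card_fin, show 1 + L + 1 + 2 = L + 4 from by omega] at h
  exact h

end Layer6

section Layer6Ring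

variable {F : Type*} [CommRing F] {n : ℕ}

/-- **"Apply the map `Φ^{-1}`"** (p0036 L961): from a program for `Φ(f) ∈ F[z, x]` one gets a
program for `f` with the SAME budget and length — set `z := 1` (partial evaluation) and shift
back `x_{i+1} ↦ x_i − α_i` (an affine univariate substitution into `F[x]`).
[cite: DuttaDwivediSaxena2022, §3 proof of Thm. 3.2, "Size blowup" (full version p0036 L959–961)] -/
theorem UABPComputesLen.of_aeval_phi {S L : ℕ} {f : MvPolynomial (Fin n) F} (α : Fin n → F)
    (h : UABPComputesLen S L
      (aeval (fun i : Fin n => (X 0 * X i.succ + C (α i) : MvPolynomial (Fin (n + 1)) F)) f)) :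
    UABPComputesLen S L f := by
  classical
  -- `z := 1`, then `x_0 ↦ 0`, `x_{i+1} ↦ x_i - α_i`
  let κ : Fin (n + 1) → MvPolynomial (Fin n) F := Fin.cases 0 fun i => X i - C (α i)
  have hκvars : ∀ j, (κ j).vars.card ≤ 1 := by
    intro j
    cases j using Fin.cases with
    | zero => simp [κ]
    | succ i =>
      simp only [κ, Fin.cases_succ]
      refine (Finset.card_le_card (vars_sub_subset (X i : MvPolynomial (Fin n) F))).trans ?_
      rw [vars_C, Finset.union_empty]
      exact card_vars_X_le_one (F := F) i
  have hκdeg : ∀ j, (κ j).totalDegree ≤ 1 := by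
    intro j
    cases j using Fin.cases with
    | zero => simp [κ]
    | succ i =>
      simp only [κ, Fin.cases_succ]
      exact (totalDegree_sub _ _).trans (max_le (totalDegree_X_le_one (F := F) i) (by simp))
  have h2 := (h.eval_var 0 1).bind₁_affine' κ hκvars hκdeg
  convert h2 using 1
  symm
  rw [aeval_eq_bind₁, bind₁_bind₁, bind₁_bind₁]
  have hφ : (fun i : Fin n => bind₁ (fun j => bind₁ κ (Function.update X 0 (C 1) j))
      (X 0 * X i.succ + C (α i) : MvPolynomial (Fin (n + 1)) F)) = X := by
    funext i
    simp [κ]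
  rw [hφ, bind₁_X_left]
  rfl

end Layer6Ring

/-! ## Layer 7: univariate substitutions; Strassen's division elimination (DDS Lemma 2.6) PROVED

DDS Lemma 2.6 (p0018 L481–485, "[115]" = Strassen 1973): "Let `g(x, y)` and `h(x, y)` be computed
by ABPs of size `s` and degree `< d`. Further, assume `h(x, 0) ≠ 0`. Then, `g/h mod y^d` can be
written as `∑_{i=0}^{d−1} C_i · y^i`, where each `C_i` is of the form ABP/ABP of size `O(s d^2)`.
Moreover, in case `g/h` is a polynomial, then it has an ABP of size `O(s d^2)`." The printed
proof of the "moreover" part (p0018 L489–498): pick a point with `h(a) ≠ 0`, shift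
(`h(x + a) =: h(a) − h̃` with `h̃ ∈ ⟨x⟩`), "Using the inverse identity in `F[[x]]`, we have
`g'/h(a)·(1 − h̃/h(a))^{-1} ≡ (g'/h(a)) · ∑_{0 ≤ i < d} (h̃/h(a))^i mod ⟨x⟩^d`", "ABPs are closed
under addition/multiplication; thus, we get an ABP … This implies the ABP-size for `g/h` as
well." Below: `UABPComputesLen.divElim` is exactly this construction on `UABPComputesLen`
witnesses (shift `bind₁_affine`, `smul_C`, `geom_sum`, `mul`, degree truncation `truncate`,
shift back), with the point `a` such that `h(a) ≠ 0` as a HYPOTHESIS (the print: "a random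
`(a, a_0) ∈ F^{n+1}`") and every label budget explicit; `UABPComputes.divElim` eliminates the
lengths and bounds everything by `100 · s^5` for one parameter `s`; over an infinite field the
point exists (`UABPComputes.divElim_of_infinite`). This is the step "eliminate the division as
in the proof of Claim 3.7 to obtain an `ε`-free ABP over `F[x, z]` computing `Φ(f)`" at the end of
the proof of Thm. 3.2 (p0036 L959–960). The ABP/ABP part of Lemma 2.6 (the `C_i`) is
interpolation: `eval_var` + `sum_smul_C` of Layer 2. -/

section Layer7

variable {F : Type*} [CommSemiring F] {n : ℕ}

/-- Substituting polynomials of degree `≤ e` multiplies the total degree by at most `e`.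
[folklore] -/
private theorem totalDegree_bind₁_le_mul {σ τ : Type*} (φ : σ → MvPolynomial τ F) {e : ℕ}
    (hφ : ∀ i, (φ i).totalDegree ≤ e) (f : MvPolynomial σ F) :
    (bind₁ φ f).totalDegree ≤ f.totalDegree * e := by
  classical
  conv_lhs => rw [f.as_sum]
  rw [map_sum]
  refine (totalDegree_finsetSum _ _).trans (Finset.sup_le fun d hd => ?_)
  rw [bind₁_monomial]
  refine (totalDegree_mul _ _).trans ?_
  rw [totalDegree_C, zero_add]
  refine (totalDegree_finsetProd _ _).trans ?_
  refine le_trans (Finset.sum_le_sum fun i _ => (totalDegree_pow _ _).trans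
    (Nat.mul_le_mul_left _ (hφ i))) ?_
  rw [← Finset.sum_mul]
  exact Nat.mul_le_mul_right _ (by simpa [Finsupp.sum] using le_totalDegree hd)

/-- **Univariate substitutions** `x_j ↦ φ j` with each `φ j` involving at most one variable and of
degree `≤ e` (`1 ≤ e`; e.g. Kronecker-type maps `x_j ↦ y^{k_j}`, dilations, univariate shifts):
label by label — same vertices and length, label degrees multiplied by `e` (budget `S · e`).
[cite: DuttaDwivediSaxena2022, Def. 2.5 (full version p0017 L468 – p0018 L476)] -/
theorem UABPComputesLen.bind₁_univariate {n' S L e : ℕ} {f : MvPolynomial (Fin n) F}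
    (hf : UABPComputesLen S L f) (φ : Fin n → MvPolynomial (Fin n') F) (he : 1 ≤ e)
    (hvars : ∀ j, (φ j).vars.card ≤ 1) (hdeg : ∀ j, (φ j).totalDegree ≤ e) :
    UABPComputesLen (S * e) L (bind₁ φ f) := by
  obtain ⟨V, hV, layer, s, t, N, hlay, hlab, hst, hf⟩ := hf
  refine ⟨V, hV.trans (Nat.le_mul_of_pos_right S he), layer, s, t, N.map (bind₁ φ), ?_, ?_, hst,
    ?_⟩
  · intro u v h
    exact hlay u v fun h0 => h (by rw [Matrix.map_apply, h0, map_zero])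
  · intro u v
    exact ⟨card_vars_bind₁_le_one φ hvars _ (hlab u v).1,
      (totalDegree_bind₁_le_mul φ hdeg _).trans (Nat.mul_le_mul_right e (hlab u v).2)⟩
  · have hpow : (N.map (bind₁ φ)) ^ L = (N ^ L).map (bind₁ φ) := by
      have h := ((bind₁ φ).toRingHom.mapMatrix (m := Fin V)).map_pow N L
      simpa [RingHom.mapMatrix_apply] using h.symm
    rw [hpow, Matrix.map_apply, hf]

/-- The shift `x_i ↦ x_i + a_i` is univariate of degree `≤ 1` in each coordinate: variables.
[folklore] -/
private theorem card_vars_X_add_C_le_one (a : Fin n → F) (i : Fin n) :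
    (X i + C (a i) : MvPolynomial (Fin n) F).vars.card ≤ 1 := by
  classical
  refine (Finset.card_le_card (vars_add_subset _ _)).trans ?_
  rw [vars_C, Finset.union_empty]
  exact card_vars_X_le_one (F := F) i

/-- The shift `x_i ↦ x_i + a_i` is univariate of degree `≤ 1` in each coordinate: degree.
[folklore] -/
private theorem totalDegree_X_add_C_le_one (a : Fin n → F) (i : Fin n) :
    (X i + C (a i) : MvPolynomial (Fin n) F).totalDegree ≤ 1 :=
  (totalDegree_add _ _).trans (max_le (totalDegree_X_le_one (F := F) i) (by simp))

/-- The constant term after the shift `x ↦ x + a` is the value at `a`. [folklore] -/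
private theorem coeff_zero_bind₁_X_add_C (a : Fin n → F) (h : MvPolynomial (Fin n) F) :
    coeff 0 (bind₁ (fun i => X i + C (a i)) h) = eval a h := by
  rw [← constantCoeff_eq, ← eval_zero]
  show eval₂Hom (RingHom.id F) (0 : Fin n → F) (bind₁ (fun i => X i + C (a i)) h) = eval a h
  rw [eval₂Hom_bind₁]
  have h2 : (fun i : Fin n => eval₂Hom (RingHom.id F) (0 : Fin n → F)
      (X i + C (a i) : MvPolynomial (Fin n) F)) = a := by
    funext i
    simp
  rw [h2]
  rfl

/-- If all homogeneous components of `u` below `N` vanish then so do those of `v * u`.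
[folklore] -/
private theorem homogeneousComponent_mul_eq_zero_of_lt {u v : MvPolynomial (Fin n) F} {N : ℕ}
    (hu : ∀ m < N, homogeneousComponent m u = 0) {m : ℕ} (hm : m < N) :
    homogeneousComponent m (v * u) = 0 := by
  rw [homogeneousComponent_mul_eq_sum]
  exact Finset.sum_eq_zero fun i _ => by rw [hu (m - i) (by omega), mul_zero]

/-- Powers of a polynomial without constant term: `u^N` has no homogeneous component below `N`.
[folklore] -/
private theorem homogeneousComponent_pow_eq_zero_of_coeff_zero {u : MvPolynomial (Fin n) F}
    (h0 : coeff 0 u = 0) : ∀ (N m : ℕ), m < N → homogeneousComponent m (u ^ N) = 0 := by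
  intro N
  induction N with
  | zero => intro m hm; exact absurd hm (Nat.not_lt_zero m)
  | succ N ih =>
    intro m hm
    rw [pow_succ, homogeneousComponent_mul_eq_sum]
    refine Finset.sum_eq_zero fun i hi => ?_
    rw [Finset.mem_range] at hi
    by_cases hiN : i < N
    · rw [ih i hiN, zero_mul]
    · have him : m - i = 0 := by omega
      rw [him, homogeneousComponent_zero, h0, C_0, mul_zero]

end Layer7

section Layer7Field

variable {K : Type*} [Field K] {n : ℕ}

/-- **The algebra of Strassen's division elimination** (DDS Lemma 2.6 proof, p0018 L489–498):
if `g' = (c − h̃) · q'` with `c ≠ 0`, `h̃` without constant term and `deg q' ≤ d`, then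
`q' = (part of degree ≤ d of) (g'/c) · ∑_{i ≤ d} (h̃/c)^i` — "the inverse identity in `F[[x]]`
… mod `⟨x⟩^{d}`" read exactly. [cite: DuttaDwivediSaxena2022, Lemma 2.6 proof (full version p0018 L489–498)] -/
theorem truncate_mul_geom_sum_eq_of_mul_eq {c : K} (hc : c ≠ 0) {g' u q' : MvPolynomial (Fin n) K}
    {d : ℕ} (hq : g' = (C c - u) * q') (h0 : coeff 0 u = 0) (hd : q'.totalDegree ≤ d) :
    (∑ m ∈ Finset.range (d + 1), homogeneousComponent m
        (C c⁻¹ * g' * ∑ i ∈ Finset.range (d + 1), (C c⁻¹ * u) ^ i)) = q' := by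
  set w : MvPolynomial (Fin n) K := C c⁻¹ * u with hw_def
  set P : MvPolynomial (Fin n) K := C c⁻¹ * g' * ∑ i ∈ Finset.range (d + 1), w ^ i with hP_def
  have hw0 : coeff 0 w = 0 := by
    rw [hw_def, coeff_C_mul, h0, mul_zero]
  -- `(c − u) · P = g' · (1 − w^{d+1})`
  have hcu : (C c - u) * C c⁻¹ = 1 - w := by
    rw [sub_mul, ← C_mul, mul_inv_cancel₀ hc, C_1, hw_def, mul_comm u]
  have hP : (C c - u) * P = g' * (1 - w ^ (d + 1)) := by
    rw [hP_def, show (C c - u) * (C c⁻¹ * g' * ∑ i ∈ Finset.range (d + 1), w ^ i) =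
      g' * (((C c - u) * C c⁻¹) * ∑ i ∈ Finset.range (d + 1), w ^ i) from by ring, hcu,
      mul_neg_geom_sum]
  -- `R := P − q'` satisfies `(c − u) R = −g' w^{d+1}`, which has no components of degree `≤ d`
  have hR : (C c - u) * (P - q') = -(g' * w ^ (d + 1)) := by
    rw [mul_sub, hP, ← hq]
    ring
  have hRm : ∀ m, m ≤ d → homogeneousComponent m (P - q') = 0 := by
    intro m
    induction m using Nat.strong_induction_on with
    | _ m ih =>
      intro hm
      have h1 : homogeneousComponent m ((C c - u) * (P - q')) = 0 := by
        rw [hR, map_neg, neg_eq_zero]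
        exact homogeneousComponent_mul_eq_zero_of_lt
          (homogeneousComponent_pow_eq_zero_of_coeff_zero hw0 (d + 1)) (by omega)
      rw [homogeneousComponent_mul_eq_sum, Finset.sum_range_succ', Finset.sum_eq_zero
        fun i hi => by
          rw [Finset.mem_range] at hi
          rw [ih (m - (i + 1)) (by omega) (by omega), mul_zero],
        zero_add, Nat.sub_zero, homogeneousComponent_zero, coeff_sub, coeff_C, if_pos rfl, h0,
        sub_zero] at h1
      rcases mul_eq_zero.1 h1 with h2 | h2
      · exact absurd (C_eq_zero.1 h2) hc
      · exact h2
  calc (∑ m ∈ Finset.range (d + 1), homogeneousComponent m P)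
      = ∑ m ∈ Finset.range (d + 1), homogeneousComponent m q' := by
        refine Finset.sum_congr rfl fun m hm => ?_
        rw [Finset.mem_range] at hm
        have h := hRm m (by omega)
        rw [map_sub, sub_eq_zero] at h
        exact h
    _ = q' := sum_homogeneousComponent_range_of_le q' hd

/-- **DDS Lemma 2.6 (Strassen's division elimination), polynomial case — PROVED** on
`UABPComputesLen` witnesses, with every budget explicit: if `g = h · q`, `h(a) ≠ 0`, `deg q ≤ d`,
and `g`, `h` have programs `(S₁, L₁)`, `(S₂, L₂)`, then `q` has a program — the printed
construction verbatim: shift by `a`, `h' = h(a) − h̃`, truncated inverse identity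
`(g'/h(a)) · ∑_{i ≤ d} (h̃/h(a))^i`, keep the part of degree `≤ d`, shift back (the print works
"mod `⟨x, y⟩^d`" for "degree `< d`"; here `deg q ≤ d` and "mod `⟨x⟩^{d+1}`").
[cite: DuttaDwivediSaxena2022, Lemma 2.6 and its proof (full version p0018 L481–498)] -/
theorem UABPComputesLen.divElim {S₁ L₁ S₂ L₂ d : ℕ} {g h q : MvPolynomial (Fin n) K}
    (hg : UABPComputesLen S₁ L₁ g) (hh : UABPComputesLen S₂ L₂ h) (a : Fin n → K)
    (ha : eval a h ≠ 0) (hq : g = h * q) (hd : q.totalDegree ≤ d) :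
    UABPComputesLen
      ((d + 1) * ((S₁ + 2 + ((d + 1) * ((2 + (d + 1) * (2 * (S₂ + L₂ + 7) + 2 + 2)) +
        (1 + (d + 1) * (L₂ + 4 + 2 + 1))) + 2)) * (d + 1)) + 2)
      (L₁ + 2 + ((1 + (d + 1) * (L₂ + 4 + 2 + 1)) + 2) + 1 + 2) q := by
  classical
  -- the shift and its inverse
  set θ : Fin n → MvPolynomial (Fin n) K := fun i => X i + C (a i) with hθ_def
  set c : K := eval a h with hc_def
  set g' := bind₁ θ g with hg'_def
  set h' := bind₁ θ h with hh'_def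
  set q' := bind₁ θ q with hq'_def
  set u : MvPolynomial (Fin n) K := C c - h' with hu_def
  have hg' : UABPComputesLen S₁ L₁ g' :=
    hg.bind₁_affine θ (card_vars_X_add_C_le_one a) (totalDegree_X_add_C_le_one a)
  have hh' : UABPComputesLen S₂ L₂ h' :=
    hh.bind₁_affine θ (card_vars_X_add_C_le_one a) (totalDegree_X_add_C_le_one a)
  -- `u = c − h'` has no constant term
  have hu0 : coeff 0 u = 0 := by
    rw [hu_def, coeff_sub, coeff_C, if_pos rfl, hh'_def, hθ_def, coeff_zero_bind₁_X_add_C, ← hc_def,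
      sub_self]
  have hu : UABPComputesLen (2 * (S₂ + L₂ + 7) + 2) (L₂ + 4) u := by
    have h1 := (UABPComputesLen.of_C (n := n) (S := 2) le_rfl c).add' (hh'.smul_C (-1))
    rw [show max 1 (L₂ + 2) + 2 = L₂ + 4 from by rw [max_eq_right (by omega)],
      show (C c + C (-1) * h' : MvPolynomial (Fin n) K) = u from by rw [hu_def, C_neg, C_1]; ring]
      at h1
    exact h1.mono (by omega)
  -- the truncated inverse identity, as a program
  have hP := (hg'.smul_C c⁻¹).mul ((hu.smul_C c⁻¹).geom_sum (d + 1))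
  have htr := hP.truncate d
  -- it computes `q'`
  have hq' : g' = (C c - u) * q' := by
    rw [hu_def, sub_sub_cancel, hg'_def, hh'_def, hq'_def, hq, map_mul]
  have hd' : q'.totalDegree ≤ d :=
    (totalDegree_bind₁_le_of_le_one θ (totalDegree_X_add_C_le_one a) q).trans hd
  rw [truncate_mul_geom_sum_eq_of_mul_eq ha hq' hu0 hd'] at htr
  -- shift back
  have hback := htr.bind₁_affine (fun i => X i - C (a i))
    (fun i => by
      refine (Finset.card_le_card (vars_sub_subset (X i : MvPolynomial (Fin n) K))).trans ?_
      rw [vars_C, Finset.union_empty]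
      exact card_vars_X_le_one (F := K) i)
    (fun i => (totalDegree_sub _ _).trans (max_le (totalDegree_X_le_one (F := K) i) (by simp)))
  have hqq : bind₁ (fun i => X i - C (a i)) q' = q := by
    rw [hq'_def, bind₁_bind₁, hθ_def]
    have hφ : (fun i : Fin n => bind₁ (fun j => X j - C (a j)) (X i + C (a i) :
        MvPolynomial (Fin n) K)) = X := by
      funext i
      simp
    rw [hφ, bind₁_X_left]
    rfl
  rw [hqq] at hback
  exact hback

/-- Polynomial bound used to absorb the explicit budget of `divElim` into `100 · s^5`.
[folklore] -/
private theorem divElim_budget_le {S₁ S₂ L₂ d s : ℕ} (hs : 2 ≤ s) (h1 : S₁ ≤ s) (h2 : S₂ ≤ s)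
    (h4 : L₂ ≤ s) (h5 : d ≤ s) :
    (d + 1) * ((S₁ + 2 + ((d + 1) * ((2 + (d + 1) * (2 * (S₂ + L₂ + 7) + 2 + 2)) +
        (1 + (d + 1) * (L₂ + 4 + 2 + 1))) + 2)) * (d + 1)) + 2 ≤ 100 * s ^ 5 := by
  calc (d + 1) * ((S₁ + 2 + ((d + 1) * ((2 + (d + 1) * (2 * (S₂ + L₂ + 7) + 2 + 2)) +
        (1 + (d + 1) * (L₂ + 4 + 2 + 1))) + 2)) * (d + 1)) + 2
      ≤ (s + 1) * ((s + 2 + ((s + 1) * ((2 + (s + 1) * (2 * (s + s + 7) + 2 + 2)) +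
        (1 + (s + 1) * (s + 4 + 2 + 1))) + 2)) * (s + 1)) + 2 := by gcongr
    _ = 5 * s ^ 5 + 45 * s ^ 4 + 134 * s ^ 3 + 185 * s ^ 2 + 123 * s + 34 := by ring
    _ ≤ 100 * s ^ 5 := by
        have e2 : 2 * s ≤ s ^ 2 := by nlinarith
        have e3 : 2 * s ^ 2 ≤ s ^ 3 := by nlinarith
        have e4 : 2 * s ^ 3 ≤ s ^ 4 := by nlinarith
        have e5 : 2 * s ^ 4 ≤ s ^ 5 := by nlinarith
        omega

/-- **DDS Lemma 2.6 ("moreover" part) in the tree's currency** — "in case `g/h` is a polynomial,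
then it has an ABP of size `O(s d^2)`" — with one explicit polynomial budget: for a parameter
`s ≥ 2` dominating the budgets of `g` and `h` and the degree bound `d` of the quotient,
`UABPComputes (100 · s^5) q`. (Lengths are eliminated by `length_lt`.) SIZE BOUND WEAKER THAN
PRINT: the printed bound is `O(s d^2)` (in the printed size measure `d w² Δ`); here vertices and
label degrees are only bounded by `100 · s^5` for one parameter `s ≥ max(S₁, S₂, d, 2)` — a
polynomial bound as needed for Thm. 3.2's `s^{O(k·7^k)}`, with no attempt to match the printed
exponent. [cite: DuttaDwivediSaxena2022, Lemma 2.6 (full version p0018 L481–485)] -/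
theorem UABPComputes.divElim {S₁ S₂ d s : ℕ} {g h q : MvPolynomial (Fin n) K}
    (hg : UABPComputes S₁ g) (hh : UABPComputes S₂ h) (a : Fin n → K) (ha : eval a h ≠ 0)
    (hq : g = h * q) (hd : q.totalDegree ≤ d) (hs : 2 ≤ s) (h1 : S₁ ≤ s) (h2 : S₂ ≤ s)
    (h3 : d ≤ s) : UABPComputes (100 * s ^ 5) q := by
  have hh0 : h ≠ 0 := fun h0 => ha (by rw [h0, map_zero])
  by_cases hg0 : g = 0
  · have hq0 : q = 0 := by
      rcases mul_eq_zero.1 (hg0 ▸ hq).symm with h' | h'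
      · exact absurd h' hh0
      · exact h'
    rw [hq0]
    have h5 : 1 ≤ s ^ 5 := Nat.one_le_pow 5 s (by omega)
    exact (UABPComputesLen.zero (by omega) 0).uabpComputes
  obtain ⟨L₁, hgL⟩ := hg.exists_len
  obtain ⟨L₂, hhL⟩ := hh.exists_len
  have hL₂ : L₂ < S₂ := hhL.length_lt hh0
  exact ((hgL.divElim hhL a ha hq hd).mono
    (divElim_budget_le hs h1 h2 (by omega) h3)).uabpComputes

/-- Over an infinite field the point with `h(a) ≠ 0` exists, so: `g = h · q`, `h ≠ 0`,
`deg q ≤ d` ⇒ `UABPComputes (100 · s^5) q` (DDS Lemma 2.6, "a random evaluation point … guarantees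
that field element `h(a, a_0) ≠ 0`", p0018 L491–492).
[cite: DuttaDwivediSaxena2022, Lemma 2.6 and its proof (full version p0018 L481–498)] -/
theorem UABPComputes.divElim_of_infinite [Infinite K] {S₁ S₂ d s : ℕ}
    {g h q : MvPolynomial (Fin n) K} (hg : UABPComputes S₁ g) (hh : UABPComputes S₂ h)
    (hh0 : h ≠ 0) (hq : g = h * q) (hd : q.totalDegree ≤ d) (hs : 2 ≤ s) (h1 : S₁ ≤ s)
    (h2 : S₂ ≤ s) (h3 : d ≤ s) : UABPComputes (100 * s ^ 5) q := by
  have hex : ∃ a : Fin n → K, eval a h ≠ 0 := by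
    by_contra hcon
    simp only [not_exists, ne_eq, not_not] at hcon
    exact hh0 (MvPolynomial.funext fun x => by rw [hcon x, map_zero])
  obtain ⟨a, ha⟩ := hex
  exact hg.divElim hh a ha hq hd hs h1 h2 h3

end Layer7Field

/-! ## Layer 8: the "mod `z^D`" operator of the tree and termwise integration, on programs

`Literature.RingTheory.MvPolynomial.truncDegreeOf i D` (keep the monomials of `x_i`-degree `< D`;
congruence modulo `x_i^D` is `truncDegreeOf i D p = truncDegreeOf i D q`) is the one operator in
which the "`R_j = F[z]/⟨z^{d_j}⟩`" bookkeeping of DDS §3 is stated across the DDS21 files; here it is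
attached to programs (it is `truncateWeighted (Pi.single i 1)` re-indexed), together with the
termwise integration `integrateDegreeOf` of the trace-back step (Claim 3.7, "definite integration",
p0034 L913–914) and length-free restatements of the Layer 6 operations. -/

section Layer8

open Literature.RingTheory.MvPolynomial

variable {F : Type*} [CommSemiring F] {n : ℕ}

/-- **Reduction mod `x_i^D` of an ABP-computed polynomial** (`truncDegreeOf i D f`, the canonical
representative): budget `D · (S · D) + 2`, length `L + 2` (the `D` graded copies of weights
`0, …, D−1` in parallel; for `D = 0` the zero program). This is "mod `z^{d_j}`" of the rings `R_j`
on the ABP side. [cite: DuttaDwivediSaxena2022, §3 proof of Thm. 3.2 (full version p0028 L755, p0031 L815, p0035 L926)] -/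
theorem UABPComputesLen.truncDegreeOf (i : Fin n) {S L : ℕ} {f : MvPolynomial (Fin n) F}
    (hf : UABPComputesLen S L f) (D : ℕ) :
    UABPComputesLen (D * (S * D) + 2) (L + 2) (Literature.RingTheory.MvPolynomial.truncDegreeOf i D f) := by
  cases D with
  | zero =>
    rw [truncDegreeOf_zero_right]
    exact UABPComputesLen.zero (by omega) _
  | succ D =>
    rw [truncDegreeOf_apply]
    exact hf.truncateWeighted (Pi.single i 1) D

variable {K : Type*} [Field K]

/-- **Termwise integration in `x_i` of an ABP-computed polynomial** (`integrateDegreeOf i D f =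
∑_{k<D} (1/(k+1)) · x_i · f^{(i)}_k`): budget `D · (2 + S · D) + 2`, length `L + 4` (per `k`: one
edge `(1/(k+1)) x_i` in series with the weight-`k` graded copy; the `D` terms in parallel) — the
"definite integration `∑_i (C_i/i) · z^i`" of the trace-back step, on the ABP side.
[cite: DuttaDwivediSaxena2022, §3 proof of Thm. 3.2, Claim 3.7 (full version p0034 L913–914, p0035 L923)] -/
theorem UABPComputesLen.integrateDegreeOf (i : Fin n) {S L : ℕ} {f : MvPolynomial (Fin n) K}
    (hf : UABPComputesLen S L f) (D : ℕ) :
    UABPComputesLen (D * (2 + S * D) + 2) (L + 4) (Literature.RingTheory.MvPolynomial.integrateDegreeOf i D f) := by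
  classical
  unfold Literature.RingTheory.MvPolynomial.integrateDegreeOf
  rw [Finset.sum_range]
  have hterm : ∀ k : Fin D, UABPComputesLen (2 + S * D) (1 + L + 1)
      (C (1 / ((((k : ℕ) : ℕ) : K) + 1)) * X i *
        MvPolynomial.weightedHomogeneousComponent (Pi.single i 1) ((k : ℕ) : ℕ) f) := by
    intro k
    have hD : D - 1 + 1 = D := Nat.sub_add_cancel (Nat.one_le_of_lt k.isLt)
    have hslice := hf.weightedHomogeneousComponent (Pi.single i 1) (D := D - 1) (k := (k : ℕ))
      (by have := k.isLt; omega)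
    rw [hD] at hslice
    refine (UABPComputesLen.of_label (S := 2) le_rfl (C (1 / (((k : ℕ) : K) + 1)) * X i) ?_ ?_).mul
      hslice
    · refine (Finset.card_le_card (vars_mul _ _)).trans ?_
      rw [vars_C, Finset.empty_union]
      exact card_vars_X_le_one (F := K) i
    · exact (totalDegree_mul _ _).trans (by
        rw [totalDegree_C, zero_add]; exact (totalDegree_X_le_one (F := K) i).trans one_le_two)
  have h := UABPComputesLen.sum _ hterm
  rw [Fintype.card_fin, show 1 + L + 1 + 2 = L + 4 from by omega] at h
  exact h

/-! ### Length-free restatements (the currency `UABPComputes` of `DDS2021_thm_3_2`) -/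

/-- Re-indexing of variables on `UABPComputes` (same budget).
[cite: DuttaDwivediSaxena2022, Def. 2.5 (full version p0017 L468 – p0018 L476)] -/
theorem UABPComputes.rename {n' S : ℕ} {f : MvPolynomial (Fin n) F} (hf : UABPComputes S f)
    (g : Fin n → Fin n') : UABPComputes S (MvPolynomial.rename g f) := by
  obtain ⟨L, hf⟩ := hf.exists_len
  exact (hf.rename g).uabpComputes

/-- Change of coefficients on `UABPComputes` (same budget).
[cite: DuttaDwivediSaxena2022, Def. 2.5 (full version p0017 L468 – p0018 L476)] -/
theorem UABPComputes.map {F' : Type*} [CommSemiring F'] {S : ℕ} {f : MvPolynomial (Fin n) F}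
    (hf : UABPComputes S f) (φ : F →+* F') : UABPComputes S (MvPolynomial.map φ f) := by
  obtain ⟨L, hf⟩ := hf.exists_len
  exact (hf.map φ).uabpComputes

/-- Partial derivatives on `UABPComputes` (budget `2 S`) — "Derive".
[cite: DuttaDwivediSaxena2022, §3 proof of Thm. 3.2, "Divide and Derive" (full version p0028 L764 – p0029 L766)] -/
theorem UABPComputes.pderiv {S : ℕ} {f : MvPolynomial (Fin n) F} (hf : UABPComputes S f)
    (i : Fin n) : UABPComputes (2 * S) (MvPolynomial.pderiv i f) := by
  obtain ⟨L, hf⟩ := hf.exists_len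
  exact (hf.pderiv i).uabpComputes

/-- Weighted homogeneous components on `UABPComputes` (budget `S · (D + 1)` for `k ≤ D`).
[cite: DuttaDwivediSaxena2022, §3 proof of Thm. 3.2 (full version p0028 L755, p0031 L815)] -/
theorem UABPComputes.weightedHomogeneousComponent (w : Fin n → ℕ) {S : ℕ}
    {f : MvPolynomial (Fin n) F} (hf : UABPComputes S f) {D k : ℕ} (hk : k ≤ D) :
    UABPComputes (S * (D + 1)) (MvPolynomial.weightedHomogeneousComponent w k f) := by
  obtain ⟨L, hf⟩ := hf.exists_len
  exact (hf.weightedHomogeneousComponent w hk).uabpComputes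

/-- Reduction mod `x_i^D` on `UABPComputes` (budget `D · (S · D) + 2`).
[cite: DuttaDwivediSaxena2022, §3 proof of Thm. 3.2 (full version p0028 L755, p0031 L815, p0035 L926)] -/
theorem UABPComputes.truncDegreeOf (i : Fin n) {S : ℕ} {f : MvPolynomial (Fin n) F}
    (hf : UABPComputes S f) (D : ℕ) :
    UABPComputes (D * (S * D) + 2) (Literature.RingTheory.MvPolynomial.truncDegreeOf i D f) := by
  obtain ⟨L, hf⟩ := hf.exists_len
  exact (hf.truncDegreeOf i D).uabpComputes

/-- Termwise integration on `UABPComputes` (budget `D · (2 + S · D) + 2`).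
[cite: DuttaDwivediSaxena2022, §3 proof of Thm. 3.2, Claim 3.7 (full version p0034 L913–914)] -/
theorem UABPComputes.integrateDegreeOf (i : Fin n) {S : ℕ} {f : MvPolynomial (Fin n) K}
    (hf : UABPComputes S f) (D : ℕ) :
    UABPComputes (D * (2 + S * D) + 2) (Literature.RingTheory.MvPolynomial.integrateDegreeOf i D f) := by
  obtain ⟨L, hf⟩ := hf.exists_len
  exact (hf.integrateDegreeOf i D).uabpComputes

/-- The DiDIL map `Φ` on `UABPComputes` (budget `(D+1) · (D + 2 + S · (D+1)) + 2`).
[cite: DuttaDwivediSaxena2022, §3 proof of Thm. 3.2, "Φ homomorphism" (full version p0028 L751–757)] -/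
theorem UABPComputes.aeval_phi {S D : ℕ} {f : MvPolynomial (Fin n) F} (hf : UABPComputes S f)
    (hD : f.totalDegree ≤ D) (α : Fin n → F) :
    UABPComputes ((D + 1) * (D + 2 + S * (D + 1)) + 2)
      (aeval (fun i : Fin n => (X 0 * X i.succ + C (α i) : MvPolynomial (Fin (n + 1)) F)) f) := by
  obtain ⟨L, hf⟩ := hf.exists_len
  exact (hf.aeval_phi hD α).uabpComputes

end Layer8

section Layer8Ring

variable {F : Type*} [CommRing F] {n : ℕ}

/-- "Apply `Φ^{-1}`" on `UABPComputes` (same budget).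
[cite: DuttaDwivediSaxena2022, §3 proof of Thm. 3.2, "Size blowup" (full version p0036 L959–961)] -/
theorem UABPComputes.of_aeval_phi {S : ℕ} {f : MvPolynomial (Fin n) F} (α : Fin n → F)
    (h : UABPComputes S
      (aeval (fun i : Fin n => (X 0 * X i.succ + C (α i) : MvPolynomial (Fin (n + 1)) F)) f)) :
    UABPComputes S f := by
  obtain ⟨L, h⟩ := h.exists_len
  exact (UABPComputesLen.of_aeval_phi α h).uabpComputes

end Layer8Ring

end DDS2021

end Literature.Computability.AlgebraicComplexity
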